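import Literature.Topology.FourManifolds.LadderProfiles
import Literature.Topology.FourManifolds.FlowerHandlebody
import HarnessLib

/-!
# The ladder: an explicit planar Morse function presenting a disc with `k` holes, with straight
# product bridges

Topic `Literature/Topology/FourManifolds`; brick E0-q (part 2) of the constructive road (P1′) to
`Literature.Topology.FourManifolds.Trisection.isConnectedSum_of_reducing_separating`
(`ReducibleTrisectionSplitting.lean`, § Status), sequel of `LadderProfiles.lean`.  For every `k`
and every admissible parameter `P : Ladder.Params k` we define the **ladder**

  `q(x, y) = τ x + p(-x) + p(x - x_R) + y² + s(x)² - (κ/2)·S(4 s(x) y/κ) + p(y - 2) + p(-y - 2)`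

on `ℝ²` (`Ladder.ladder`), where `S = smoothAbs` is the regularised absolute value of
`RegularisedMax.lean` (`y² + s² - (κ/2) S(4sy/κ)` is the regularised minimum of the two parabolas
`(y ∓ s)²` in closed form), `p = Ladder.barrier` the convex barrier of `LadderProfiles.lean`,
`x_R = 4k + 1`, and the *rail separation* `s(x) = smoothStep 0 1 (x) · √(1 - 2 Σ_{i<k} b(x - 4i - 4))`
(`Ladder.sFun`; `b` the bump of `LegendrianStabilisationModel.lean`): `s = 0` for `x ≤ 0` (one
well), `s` ramps up to `1` on `[0, 1]` (the rails are born), `s = 1` on the gaps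
`[4i + 1, 4i + 3]`, and in the cell `(4i + 3, 4i + 5)` the separation dips
(`s² = 1 - 2 b(x - 4i - 4)`) and recovers.

Contents.  §1–§3: the definitions, smoothness and the **bridge identity** — on the slab ranges
`|x - (4i + 2)| ≤ 1/2` and for `κ/4 ≤ |y| ≤ 2` the ladder IS `τ x + (|y| - 1)²`
(`ladder_eq_bridge`), so that the slice of the sublevel set `{q ≤ c}` over such `x` is a pair of
intervals `|y ∓ 1| ≤ √(c - τ x)` (used by the sequel on slab straightening).  §4: the differential
(`hasFDerivAt_ladder`).  §5–§6: **the critical set** is exactly the minimum `(-t₀, 0)` of the left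
cap and, in each cell, the hole maximum `(4i + 4 + x₁, 0)` and the rung saddle `(4i + 4 + x₂, 0)`
(`isMCriticalPt_iff_mem`; the side branches `y = ± s σ(4sy/κ)` are excluded by the slope bound
`4 s² m₀ > κ`, `eq_zero_of_eq_mul_smoothSign`).  §7: the Hessians there are diagonal with the
expected signs (`mhessian_pt`, indices `0`, `2`, `1`).  §8–§10: values versus the level
`c = 1 - b(x₁) - b(x₂) - κ S(0)/2` (`1/8 < c < 1 - κ`), coercivity, and the packaging
`IsHoledDiscMorseFunction k (ladder P) (level P)` (`Params.isHoledDiscMorseFunction`,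
`Params.exists_ladder`), whence `ThickenedHandlebodyFour.lean` makes `{q + z² + w² ≤ c} ⊂ ℝ⁴` a
compact connected orientable `4`-manifold with boundary with one `0`-handle and `k` `1`-handles.
Everything is **proved**; definitions with bodies, no named fact.

## References
* J. Milnor, *Lectures on the h-cobordism theorem* (1965), §8 (explicit local models for inserting
  critical points). [MilnorHCobordism1965]
* A. Juhász, *Differential and Low-Dimensional Topology* (2023), §3.5 (handlebodies as thickened
  planar domains). [Juhasz2023]
-/

noncomputable section

open scoped Topology ContDiff Manifold
open Set Filter Real
open Literature.Analysis.Pluripotential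
open Literature.Geometry.Symplectic.LegendrianModel (bump dbump hasDerivAt_bump deriv_bump bump_pos
  bump_eq_zero bump_nonneg bump_le_bump_zero bump_lt_bump continuous_dbump dbump_eq_zero dbump_zero
  dbump_pos_of_neg dbump_neg_of_pos contDiff_bump continuous_bump bump_pos_iff)

namespace Literature.Topology.FourManifolds

/-- Local notation: `𝔼 n` is the model Euclidean space `EuclideanSpace ℝ (Fin n)`. -/
local notation "𝔼 " n:arg => EuclideanSpace ℝ (Fin n)

namespace Ladder

/-! ### §1 The rail separation `s(x)` -/

/-- Centre of the `i`-th cell, `4i + 4`. [folklore] -/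
def ctr (i : ℕ) : ℝ := 4 * i + 4

/-- Right end of the ladder, `x_R = 4k + 1`. [folklore] -/
def xR (k : ℕ) : ℝ := 4 * k + 1

/-- `u(x) = 1 - 2 Σ_{i<k} b(x - ctr i)` (the square of the separation right of the ramp). [folklore] -/
def uCell (k : ℕ) (x : ℝ) : ℝ := 1 - 2 * ∑ i ∈ Finset.range k, bump (x - ctr i)

/-- Two bumps of different cells are never positive at the same point (the cells are `4` apart,
the bumps have radius `1`). [folklore] -/
theorem eq_of_bump_pos_of_bump_pos {x : ℝ} {i j : ℕ} (hi : 0 < bump (x - ctr i))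
    (hj : 0 < bump (x - ctr j)) : i = j := by
  have h1 := abs_lt.1 (bump_pos_iff.1 hi)
  have h2 := abs_lt.1 (bump_pos_iff.1 hj)
  unfold ctr at h1 h2
  have h3 : |((i : ℝ)) - (j : ℝ)| < 1 := by rw [abs_lt]; constructor <;> linarith
  have h4 : |((i : ℤ) : ℝ) - ((j : ℤ) : ℝ)| < 1 := by simpa using h3
  rw [← Int.cast_sub, ← Int.cast_abs] at h4
  have h5 : |(i : ℤ) - j| < 1 := by exact_mod_cast h4
  have : (i : ℤ) = j := by
    rcases abs_lt.1 h5 with ⟨h6, h7⟩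
    omega
  exact_mod_cast this

/-- If the `i`-th bump is positive at `x` (`i < k`), the sum of the bumps is that bump. [folklore] -/
theorem sum_bump_eq_of_pos {k i : ℕ} (hi : i < k) {x : ℝ} (h : 0 < bump (x - ctr i)) :
    ∑ j ∈ Finset.range k, bump (x - ctr j) = bump (x - ctr i) := by
  rw [Finset.sum_eq_single_of_mem i (Finset.mem_range.2 hi)]
  intro j _ hji
  by_contra hne
  exact hji (eq_of_bump_pos_of_bump_pos (lt_of_le_of_ne (bump_nonneg _) (Ne.symm hne)) h)

/-- The same for the derivatives. [folklore] -/
theorem sum_dbump_eq_of_pos {k i : ℕ} (hi : i < k) {x : ℝ} (h : 0 < bump (x - ctr i)) :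
    ∑ j ∈ Finset.range k, dbump (x - ctr j) = dbump (x - ctr i) := by
  rw [Finset.sum_eq_single_of_mem i (Finset.mem_range.2 hi)]
  intro j _ hji
  apply dbump_eq_zero
  by_contra hlt
  exact hji (eq_of_bump_pos_of_bump_pos (bump_pos (not_le.1 hlt)) h)

/-- The sum of the bumps is at most `b(0)`. [folklore] -/
theorem sum_bump_le (k : ℕ) (x : ℝ) : ∑ j ∈ Finset.range k, bump (x - ctr j) ≤ bump 0 := by
  by_cases h : ∃ i < k, 0 < bump (x - ctr i)
  · obtain ⟨i, hi, hpos⟩ := h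
    rw [sum_bump_eq_of_pos hi hpos]
    exact bump_le_bump_zero _
  · push Not at h
    rw [Finset.sum_eq_zero fun j hj => le_antisymm (h j (Finset.mem_range.1 hj)) (bump_nonneg _)]
    exact bump_nonneg 0

/-- The sum of the bumps is nonnegative. [folklore] -/
theorem sum_bump_nonneg (k : ℕ) (x : ℝ) : 0 ≤ ∑ j ∈ Finset.range k, bump (x - ctr j) :=
  Finset.sum_nonneg fun _ _ => bump_nonneg _

/-- `b(0) = e⁻¹ < 1/2`. [folklore] -/
theorem bump_zero_lt_half : bump 0 < 1 / 2 := by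
  rw [bump_zero]
  have h := Real.exp_one_gt_d9
  rw [Real.exp_neg, inv_lt_comm₀ (Real.exp_pos 1) (by norm_num)]
  linarith

/-- The floor `u_min = 1 - 2 b(0) > 0`. [folklore] -/
theorem uMin_pos : 0 < 1 - 2 * bump 0 := by linarith [bump_zero_lt_half]

/-- `u ≥ 1 - 2 b(0)`. [folklore] -/
theorem uMin_le_uCell (k : ℕ) (x : ℝ) : 1 - 2 * bump 0 ≤ uCell k x := by
  unfold uCell; linarith [sum_bump_le k x]

/-- `u > 0`. [folklore] -/
theorem uCell_pos (k : ℕ) (x : ℝ) : 0 < uCell k x := uMin_pos.trans_le (uMin_le_uCell k x)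

/-- `u ≤ 1`. [folklore] -/
theorem uCell_le_one (k : ℕ) (x : ℝ) : uCell k x ≤ 1 := by
  unfold uCell; linarith [sum_bump_nonneg k x]

/-- Off the cells `u = 1`. [folklore] -/
theorem uCell_eq_one {k : ℕ} {x : ℝ} (h : ∀ i < k, 1 ≤ |x - ctr i|) : uCell k x = 1 := by
  unfold uCell
  rw [Finset.sum_eq_zero fun j hj => bump_eq_zero (h j (Finset.mem_range.1 hj))]
  ring

/-- In the `i`-th cell `u = 1 - 2 b(x - ctr i)`. [folklore] -/
theorem uCell_eq_cell {k i : ℕ} (hi : i < k) {x : ℝ} (hx : |x - ctr i| < 1) :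
    uCell k x = 1 - 2 * bump (x - ctr i) := by
  unfold uCell; rw [sum_bump_eq_of_pos hi (bump_pos hx)]

/-- Left of `3` all bumps vanish: `u = 1` there. [folklore] -/
theorem uCell_eq_one_of_le_three {k : ℕ} {x : ℝ} (hx : x ≤ 3) : uCell k x = 1 :=
  uCell_eq_one fun i _ => by
    unfold ctr
    have : (0 : ℝ) ≤ i := Nat.cast_nonneg i
    rw [abs_of_nonpos (by linarith)]
    linarith

/-- `u` is smooth. [folklore] -/
theorem contDiff_uCell (k : ℕ) : ContDiff ℝ ∞ (uCell k) := by
  unfold uCell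
  exact contDiff_const.sub (contDiff_const.mul (ContDiff.sum fun i _ =>
    contDiff_bump.comp (contDiff_id.sub contDiff_const)))

/-- `u' = -2 Σ b'(x - ctr i)`. [folklore] -/
theorem hasDerivAt_uCell (k : ℕ) (x : ℝ) :
    HasDerivAt (uCell k) (-2 * ∑ i ∈ Finset.range k, dbump (x - ctr i)) x := by
  unfold uCell
  have h : HasDerivAt (fun x => ∑ i ∈ Finset.range k, bump (x - ctr i))
      (∑ i ∈ Finset.range k, dbump (x - ctr i)) x := by
    refine HasDerivAt.fun_sum fun i _ => ?_
    have h1 := (hasDerivAt_bump (x - ctr i)).comp x ((hasDerivAt_id x).sub_const (ctr i))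
    rw [mul_one] at h1
    exact h1
  have := (h.const_mul 2).const_sub 1
  simpa [neg_mul] using this

/-- **The rail separation** `s(x) = smoothStep 0 1 (x) · √u(x)`. [folklore] -/
def sFun (k : ℕ) (x : ℝ) : ℝ := smoothStep 0 1 x * Real.sqrt (uCell k x)

/-- `s` is smooth (`u > 0`). [folklore] -/
theorem contDiff_sFun (k : ℕ) : ContDiff ℝ ∞ (sFun k) :=
  (contDiff_smoothStep 0 1).mul ((contDiff_uCell k).sqrt fun x => (uCell_pos k x).ne')

/-- `s` is continuous. [folklore] -/
theorem continuous_sFun (k : ℕ) : Continuous (sFun k) := (contDiff_sFun k).continuous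

/-- `s ≥ 0`. [folklore] -/
theorem sFun_nonneg (k : ℕ) (x : ℝ) : 0 ≤ sFun k x :=
  mul_nonneg (smoothStep_mem_Icc 0 1 x).1 (Real.sqrt_nonneg _)

/-- `s ≤ 1`. [folklore] -/
theorem sFun_le_one (k : ℕ) (x : ℝ) : sFun k x ≤ 1 := by
  unfold sFun
  have h1 := smoothStep_mem_Icc 0 1 x
  have h2 : Real.sqrt (uCell k x) ≤ 1 := Real.sqrt_le_one.2 (uCell_le_one k x)
  calc smoothStep 0 1 x * Real.sqrt (uCell k x) ≤ 1 * 1 :=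
        mul_le_mul h1.2 h2 (Real.sqrt_nonneg _) zero_le_one
    _ = 1 := one_mul 1

/-- `s = 0` for `x ≤ 0`. [folklore] -/
theorem sFun_of_nonpos {k : ℕ} {x : ℝ} (hx : x ≤ 0) : sFun k x = 0 := by
  unfold sFun; rw [smoothStep_of_le zero_lt_one hx, zero_mul]

/-- `s² = u` for `x ≥ 1`. [folklore] -/
theorem sFun_sq {k : ℕ} {x : ℝ} (hx : 1 ≤ x) : sFun k x ^ 2 = uCell k x := by
  unfold sFun
  rw [smoothStep_of_ge zero_lt_one hx, one_mul, Real.sq_sqrt (uCell_pos k x).le]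

/-- `s² ≤ u` everywhere. [folklore] -/
theorem sFun_sq_le (k : ℕ) (x : ℝ) : sFun k x ^ 2 ≤ uCell k x := by
  unfold sFun
  have h1 := smoothStep_mem_Icc 0 1 x
  rw [mul_pow, Real.sq_sqrt (uCell_pos k x).le]
  calc smoothStep 0 1 x ^ 2 * uCell k x ≤ 1 ^ 2 * uCell k x := by
        gcongr
        · exact (uCell_pos k x).le
        · exact h1.1
        · exact h1.2
    _ = uCell k x := by ring

/-- `s = 1` right of the ramp and off the cells. [folklore] -/
theorem sFun_eq_one {k : ℕ} {x : ℝ} (hx : 1 ≤ x) (h : ∀ i < k, 1 ≤ |x - ctr i|) : sFun k x = 1 := by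
  unfold sFun; rw [smoothStep_of_ge zero_lt_one hx, one_mul, uCell_eq_one h, Real.sqrt_one]

/-- On the ramp and the first gap (`x ≤ 3`), `s = smoothStep 0 1`. [folklore] -/
theorem sFun_of_le_three {k : ℕ} {x : ℝ} (hx : x ≤ 3) : sFun k x = smoothStep 0 1 x := by
  unfold sFun; rw [uCell_eq_one_of_le_three hx, Real.sqrt_one, mul_one]

/-- `u_min ≤ s²` for `x ≥ 1`. [folklore] -/
theorem uMin_le_sFun_sq {k : ℕ} {x : ℝ} (hx : 1 ≤ x) : 1 - 2 * bump 0 ≤ sFun k x ^ 2 := by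
  rw [sFun_sq hx]; exact uMin_le_uCell k x

/-! ### §2 Parameters and the ladder -/

/-- The guaranteed gap between the bump values at the two roots: `Δ⋆ = b(1/2) - b(x⋆) > 0`.
[folklore] -/
def gapStar : ℝ := bump (1 / 2) - bump xStar

/-- `Δ⋆ > 0`. [folklore] -/
theorem gapStar_pos : 0 < gapStar := by
  unfold gapStar
  have h := bump_lt_bump (s := 1 / 2) (t := xStar)
    (by rw [abs_of_pos (by norm_num : (0:ℝ) < 1 / 2), abs_of_pos xStar_pos]; exact half_lt_xStar)
    (by rw [abs_of_pos (by norm_num : (0:ℝ) < 1 / 2)]; norm_num)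
  linarith

/-- **Admissible parameters** of the ladder with `k` cells: a tilt `τ`, a blending width `κ` and
a slope constant `m₀` for the smooth sign, small enough. [folklore] -/
structure Params (k : ℕ) where
  /-- tilt -/
  τ : ℝ
  /-- blending width -/
  κ : ℝ
  /-- slope constant of the smooth sign -/
  m₀ : ℝ
  τ_pos : 0 < τ
  τ_le_one : τ ≤ 1
  τ_lt : τ / 2 < dbump (-1 / 2)
  τ_small : τ * (4 * k + 1) ≤ min gapStar (1 / 8) / 2
  κ_pos : 0 < κ
  κ_le : κ ≤ 1 / 4
  m₀_pos : 0 < m₀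
  m₀_le : m₀ ≤ deriv smoothSign 0
  m₀_slope : ∀ t ∈ Icc (0 : ℝ) 1, m₀ * t ≤ smoothSign t
  κ_lt : κ < 4 * (1 - 2 * bump 0) * m₀

/-- **Admissible parameters exist** for every `k`. [folklore] -/
theorem exists_params (k : ℕ) : Nonempty (Params k) := by
  obtain ⟨m₀, hm₀, hm₀le, hslope⟩ := exists_slope_le_smoothSign
  have hd := dbump_neg_half_pos
  have hg := gapStar_pos
  have hu := uMin_pos
  set A : ℝ := min (min 1 (dbump (-1 / 2))) (min gapStar (1 / 8) / 2 / (4 * k + 1)) with hA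
  have hk : (0 : ℝ) < 4 * k + 1 := by positivity
  have hApos : 0 < A := by
    rw [hA]; refine lt_min (lt_min one_pos hd) (div_pos (by positivity) hk)
  set K : ℝ := min (1 / 4) (2 * (1 - 2 * bump 0) * m₀) with hK
  have h1 : A / 2 ≤ 1 := by
    have : A ≤ 1 := (min_le_left _ _).trans (min_le_left _ _)
    linarith
  have h2 : A / 2 / 2 < dbump (-1 / 2) := by
    have : A ≤ dbump (-1 / 2) := (min_le_left _ _).trans (min_le_right _ _)
    linarith
  have h3 : A / 2 * (4 * k + 1) ≤ min gapStar (1 / 8) / 2 := by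
    have h1 : A ≤ min gapStar (1 / 8) / 2 / (4 * k + 1) := min_le_right _ _
    have h2 : A * (4 * k + 1) ≤ min gapStar (1 / 8) / 2 := by
      rwa [le_div_iff₀ hk] at h1
    nlinarith
  have h4 : 0 < K := lt_min (by norm_num) (by positivity)
  have h5 : K < 4 * (1 - 2 * bump 0) * m₀ :=
    calc K ≤ 2 * (1 - 2 * bump 0) * m₀ := min_le_right _ _
      _ < 4 * (1 - 2 * bump 0) * m₀ := by nlinarith [mul_pos hu hm₀]
  exact ⟨⟨A / 2, K, m₀, by positivity, h1, h2, h3, h4, min_le_left _ _, hm₀, hm₀le, hslope, h5⟩⟩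

variable {k : ℕ} (P : Params k)

/-- The planar point `(x, y)`. [folklore] -/
def pt (x y : ℝ) : 𝔼 2 := WithLp.toLp 2 ![x, y]

/-- First coordinate of `pt`. [folklore] -/
@[simp] theorem pt_apply_zero (x y : ℝ) : pt x y 0 = x := rfl
/-- Second coordinate of `pt`. [folklore] -/
@[simp] theorem pt_apply_one (x y : ℝ) : pt x y 1 = y := rfl

/-- Every point is `pt (p 0) (p 1)`. [folklore] -/
theorem pt_eta (p : 𝔼 2) : pt (p 0) (p 1) = p := by
  ext i; fin_cases i <;> rfl

namespace Params

/-- **The ladder** `q(x, y) = τx + p(-x) + p(x - x_R) + y² + s(x)² - (κ/2) S(4 s(x) y/κ) + p(y-2) + p(-y-2)`,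
as a function of two real variables. [folklore] -/
def ladderFun (x y : ℝ) : ℝ :=
  P.τ * x + barrier (-x) + barrier (x - xR k) + y ^ 2 + sFun k x ^ 2
    - P.κ / 2 * smoothAbs (4 * sFun k x * y / P.κ) + barrier (y - 2) + barrier (-y - 2)

/-- **The ladder** on `ℝ²`. [folklore] -/
def ladder (p : 𝔼 2) : ℝ := P.ladderFun (p 0) (p 1)

/-- `ladder (pt x y) = ladderFun x y`. [folklore] -/
@[simp] theorem ladder_pt (x y : ℝ) : P.ladder (pt x y) = P.ladderFun x y := rfl

/-- The ladder is smooth. [folklore] -/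
theorem contDiff_ladder : ContDiff ℝ ∞ P.ladder := by
  have h0 : ContDiff ℝ ∞ (fun p : 𝔼 2 => p 0) := contDiff_euclidean.1 contDiff_id 0
  have h1 : ContDiff ℝ ∞ (fun p : 𝔼 2 => p 1) := contDiff_euclidean.1 contDiff_id 1
  have hs : ContDiff ℝ ∞ (fun p : 𝔼 2 => sFun k (p 0)) := (contDiff_sFun k).comp h0
  have hA : ContDiff ℝ ∞ (fun p : 𝔼 2 => smoothAbs (4 * sFun k (p 0) * p 1 / P.κ)) :=
    contDiff_smoothAbs.comp (((contDiff_const.mul hs).mul h1).div_const _)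
  have hb1 : ContDiff ℝ ∞ (fun p : 𝔼 2 => barrier (-p 0)) := contDiff_barrier.comp h0.neg
  have hb2 : ContDiff ℝ ∞ (fun p : 𝔼 2 => barrier (p 0 - xR k)) :=
    contDiff_barrier.comp (h0.sub contDiff_const)
  have hb3 : ContDiff ℝ ∞ (fun p : 𝔼 2 => barrier (p 1 - 2)) :=
    contDiff_barrier.comp (h1.sub contDiff_const)
  have hb4 : ContDiff ℝ ∞ (fun p : 𝔼 2 => barrier (-p 1 - 2)) :=
    contDiff_barrier.comp (h1.neg.sub contDiff_const)
  unfold ladder ladderFun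
  exact (((((((contDiff_const.mul h0).add hb1).add hb2).add (h1.pow 2)).add (hs.pow 2)).sub
    (contDiff_const.mul hA)).add hb3).add hb4

/-! ### §3 Values on the axis, on the gaps, and the bridge identity -/

/-- `S(0) ∈ [0, 1]`. [folklore] -/
theorem smoothAbs_zero_mem : smoothAbs 0 ∈ Icc (0 : ℝ) 1 :=
  ⟨by simpa using abs_le_smoothAbs 0, by simpa using smoothAbs_le_abs_add_one 0⟩

/-- **On the axis** `y = 0`: `q(x, 0) = τ x + p(-x) + p(x - x_R) + s(x)² - κ S(0)/2`. [folklore] -/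
theorem ladderFun_zero (x : ℝ) :
    P.ladderFun x 0 = P.τ * x + barrier (-x) + barrier (x - xR k) + sFun k x ^ 2
      - P.κ / 2 * smoothAbs 0 := by
  unfold ladderFun
  rw [barrier_of_nonpos (by norm_num : (0:ℝ) - 2 ≤ 0), barrier_of_nonpos (by norm_num : -(0:ℝ) - 2 ≤ 0)]
  simp

/-- **The regularised minimum of the two parabolas in closed form**: where `|4 s y| ≥ κ`,
`y² + s² - (κ/2) S(4sy/κ) = (|y| - s)²`. [folklore] -/
theorem sq_add_sq_sub_smoothAbs {s y κ : ℝ} (hκ : 0 < κ) (h : κ ≤ 4 * s * |y|) :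
    y ^ 2 + s ^ 2 - κ / 2 * smoothAbs (4 * s * y / κ) = (|y| - s) ^ 2 := by
  rcases le_or_gt 0 y with hy | hy
  · rw [abs_of_nonneg hy] at h ⊢
    rw [smoothAbs_of_one_le (by rw [le_div_iff₀ hκ]; linarith)]
    field_simp
    ring
  · rw [abs_of_neg hy] at h ⊢
    rw [smoothAbs_of_le_neg_one (by rw [div_le_iff₀ hκ]; linarith)]
    field_simp
    ring

/-- **The bridge identity.**  For `1 ≤ x ≤ x_R` off the cells (`1 ≤ |x - ctr i|` for all
`i < k`) and `κ/4 ≤ |y| ≤ 2`: `q(x, y) = τ x + (|y| - 1)²`. [folklore] -/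
theorem ladderFun_eq_bridge {x y : ℝ} (hx1 : 1 ≤ x) (hxR : x ≤ xR k)
    (hoff : ∀ i < k, 1 ≤ |x - ctr i|) (hy : P.κ / 4 ≤ |y|) (hy2 : |y| ≤ 2) :
    P.ladderFun x y = P.τ * x + (|y| - 1) ^ 2 := by
  unfold ladderFun
  have hs : sFun k x = 1 := sFun_eq_one hx1 hoff
  rw [hs, barrier_of_nonpos (by linarith : -x ≤ 0), barrier_of_nonpos (by linarith : x - xR k ≤ 0),
    barrier_of_nonpos (by linarith [(abs_le.1 hy2).2] : y - 2 ≤ 0),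
    barrier_of_nonpos (by linarith [(abs_le.1 hy2).1] : -y - 2 ≤ 0)]
  have key := sq_add_sq_sub_smoothAbs (s := 1) (y := y) P.κ_pos (by linarith)
  simp only [one_pow, mul_one] at key ⊢
  linarith [key]

/-- The slab ranges `|x - (4i + 2)| ≤ 1/2`, `i < k`, lie in `[1, x_R]` off the cells. [folklore] -/
theorem slab_hyps {i : ℕ} (hi : i < k) {x : ℝ} (hx : |x - (4 * i + 2)| ≤ 1 / 2) :
    1 ≤ x ∧ x ≤ xR k ∧ ∀ j < k, 1 ≤ |x - ctr j| := by
  have h := abs_le.1 hx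
  have hi0 : (0 : ℝ) ≤ i := Nat.cast_nonneg i
  have hik : (i : ℝ) + 1 ≤ k := by exact_mod_cast hi
  refine ⟨by linarith, by unfold xR; linarith, fun j _ => ?_⟩
  unfold ctr
  -- `x ∈ [4i + 3/2, 4i + 5/2]`, `ctr j = 4j + 4`: distance ≥ 3/2
  rcases lt_or_ge j i with hji | hji
  · have : (j : ℝ) + 1 ≤ i := by exact_mod_cast hji
    rw [abs_of_nonneg (by linarith)]
    linarith
  · have : (i : ℝ) ≤ j := by exact_mod_cast hji
    rw [abs_of_neg (by linarith)]
    linarith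

/-- **The bridge identity on the slab ranges**: for `|x - (4i + 2)| ≤ 1/2` (`i < k`) and
`κ/4 ≤ |y| ≤ 2`, `q(x, y) = τ x + (|y| - 1)²`. [folklore] -/
theorem ladder_eq_bridge {i : ℕ} (hi : i < k) {x y : ℝ} (hx : |x - (4 * i + 2)| ≤ 1 / 2)
    (hy : P.κ / 4 ≤ |y|) (hy2 : |y| ≤ 2) : P.ladder (pt x y) = P.τ * x + (|y| - 1) ^ 2 := by
  obtain ⟨h1, h2, h3⟩ := slab_hyps hi hx
  rw [ladder_pt]
  exact P.ladderFun_eq_bridge h1 h2 h3 hy hy2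

/-- **Inside the blending strip the ladder stays high**: for `x` as above and `|y| < κ/4`,
`q(x, y) > τ x + 1 - κ`. [folklore] -/
theorem ladderFun_gt_of_abs_lt {x y : ℝ} (hx1 : 1 ≤ x) (hxR : x ≤ xR k)
    (hoff : ∀ i < k, 1 ≤ |x - ctr i|) (hy : |y| < P.κ / 4) :
    P.τ * x + 1 - P.κ < P.ladderFun x y := by
  unfold ladderFun
  have hκ := P.κ_pos
  have hκ4 := P.κ_le
  have hs : sFun k x = 1 := sFun_eq_one hx1 hoff
  have hy2 : |y| ≤ 2 := by linarith
  rw [hs, barrier_of_nonpos (by linarith : -x ≤ 0), barrier_of_nonpos (by linarith : x - xR k ≤ 0),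
    barrier_of_nonpos (by linarith [(abs_le.1 hy2).2] : y - 2 ≤ 0),
    barrier_of_nonpos (by linarith [(abs_le.1 hy2).1] : -y - 2 ≤ 0)]
  have hS : smoothAbs (4 * 1 * y / P.κ) ≤ |4 * 1 * y / P.κ| + 1 := smoothAbs_le_abs_add_one _
  rw [abs_div, abs_of_pos hκ, abs_mul, abs_of_pos (by norm_num : (0:ℝ) < 4 * 1)] at hS
  have h1 : P.κ / 2 * smoothAbs (4 * 1 * y / P.κ) ≤ 2 * |y| + P.κ / 2 := by
    calc P.κ / 2 * smoothAbs (4 * 1 * y / P.κ) ≤ P.κ / 2 * (4 * 1 * |y| / P.κ + 1) := by gcongr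
      _ = 2 * |y| + P.κ / 2 := by field_simp; ring
  have h2 : y ^ 2 = |y| ^ 2 := (sq_abs y).symm
  nlinarith [abs_nonneg y]

/-! ### §4 The differential of the ladder -/

/-- The first coordinate functional. [folklore] -/
abbrev X0 : 𝔼 2 →L[ℝ] ℝ := EuclideanSpace.proj (0 : Fin 2)

/-- The second coordinate functional. [folklore] -/
abbrev X1 : 𝔼 2 →L[ℝ] ℝ := EuclideanSpace.proj (1 : Fin 2)

/-- `X0 p = p 0`. [folklore] -/
@[simp] theorem X0_apply (p : 𝔼 2) : X0 p = p 0 := rfl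

/-- `X1 p = p 1`. [folklore] -/
@[simp] theorem X1_apply (p : 𝔼 2) : X1 p = p 1 := rfl

/-- The derivative of the rail separation (a name for `deriv s`). [folklore] -/
def sD (k : ℕ) (x : ℝ) : ℝ := deriv (sFun k) x

/-- `s' = sD`. [folklore] -/
theorem hasDerivAt_sFun (k : ℕ) (x : ℝ) : HasDerivAt (sFun k) (sD k x) x :=
  ((contDiff_sFun k).differentiable (by simp) x).hasDerivAt

/-- **`∂q/∂x`**: `τ - p'(-x) + p'(x - x_R) + 2 s'(x) (s(x) - y σ(4 s(x) y/κ))`. [folklore] -/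
def dX (x y : ℝ) : ℝ :=
  P.τ - deriv barrier (-x) + deriv barrier (x - xR k)
    + 2 * sD k x * (sFun k x - y * smoothSign (4 * sFun k x * y / P.κ))

/-- **`∂q/∂y`**: `2y - 2 s(x) σ(4 s(x) y/κ) + p'(y - 2) - p'(-y - 2)`. [folklore] -/
def dY (x y : ℝ) : ℝ :=
  2 * y - 2 * sFun k x * smoothSign (4 * sFun k x * y / P.κ)
    + deriv barrier (y - 2) - deriv barrier (-y - 2)

/-- The differential of the ladder as a continuous linear form. [folklore] -/
def ladderD (p : 𝔼 2) : 𝔼 2 →L[ℝ] ℝ := P.dX (p 0) (p 1) • X0 + P.dY (p 0) (p 1) • X1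

/-- Evaluation of the differential. [folklore] -/
@[simp] theorem ladderD_apply (p v : 𝔼 2) :
    P.ladderD p v = P.dX (p 0) (p 1) * v 0 + P.dY (p 0) (p 1) * v 1 := by
  simp [ladderD]

/-- A one-variable function of the first coordinate. [folklore] -/
theorem hasFDerivAt_comp_X0 {g : ℝ → ℝ} {g' : ℝ} {p : 𝔼 2} (hg : HasDerivAt g g' (p 0)) :
    HasFDerivAt (fun p : 𝔼 2 => g (p 0)) (g' • X0) p :=
  hg.comp_hasFDerivAt p (X0.hasFDerivAt (x := p))

/-- A one-variable function of the second coordinate. [folklore] -/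
theorem hasFDerivAt_comp_X1 {g : ℝ → ℝ} {g' : ℝ} {p : 𝔼 2} (hg : HasDerivAt g g' (p 1)) :
    HasFDerivAt (fun p : 𝔼 2 => g (p 1)) (g' • X1) p :=
  hg.comp_hasFDerivAt p (X1.hasFDerivAt (x := p))

/-- `p'` at a point, as a `HasDerivAt` statement. [folklore] -/
theorem hasDerivAt_barrier' (t : ℝ) : HasDerivAt barrier (deriv barrier t) t :=
  (contDiff_barrier.differentiable (by simp) t).hasDerivAt

/-- **The differential of the ladder**: `dq_p = (∂q/∂x) dx + (∂q/∂y) dy`. [folklore] -/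
theorem hasFDerivAt_ladder (p : 𝔼 2) : HasFDerivAt P.ladder (P.ladderD p) p := by
  -- the summands, one by one
  have h1 : HasFDerivAt (fun p : 𝔼 2 => P.τ * p 0) ((P.τ * 1) • X0) p :=
    hasFDerivAt_comp_X0 ((hasDerivAt_id (p 0)).const_mul P.τ)
  have h2 : HasFDerivAt (fun p : 𝔼 2 => barrier (-p 0)) ((deriv barrier (-p 0) * -1) • X0) p :=
    hasFDerivAt_comp_X0 ((hasDerivAt_barrier' (-p 0)).comp (p 0) (hasDerivAt_neg (p 0)))
  have h3 : HasFDerivAt (fun p : 𝔼 2 => barrier (p 0 - xR k))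
      ((deriv barrier (p 0 - xR k) * 1) • X0) p :=
    hasFDerivAt_comp_X0 ((hasDerivAt_barrier' _).comp (p 0) ((hasDerivAt_id (p 0)).sub_const (xR k)))
  have h4 : HasFDerivAt (fun p : 𝔼 2 => p 1 ^ 2) ((↑(2 : ℕ) * p 1 ^ (2 - 1)) • X1) p :=
    hasFDerivAt_comp_X1 (hasDerivAt_pow 2 (p 1))
  have h5 : HasFDerivAt (fun p : 𝔼 2 => sFun k (p 0) ^ 2)
      ((↑(2 : ℕ) * sFun k (p 0) ^ (2 - 1) * sD k (p 0)) • X0) p :=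
    hasFDerivAt_comp_X0 ((hasDerivAt_sFun k (p 0)).pow 2)
  have h7 : HasFDerivAt (fun p : 𝔼 2 => barrier (p 1 - 2)) ((deriv barrier (p 1 - 2) * 1) • X1) p :=
    hasFDerivAt_comp_X1 ((hasDerivAt_barrier' _).comp (p 1) ((hasDerivAt_id (p 1)).sub_const 2))
  have h8 : HasFDerivAt (fun p : 𝔼 2 => barrier (-p 1 - 2))
      ((deriv barrier (-p 1 - 2) * -1) • X1) p :=
    hasFDerivAt_comp_X1 ((hasDerivAt_barrier' _).comp (p 1) ((hasDerivAt_neg (p 1)).sub_const 2))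
  -- the regularised term `(κ/2) S(4 s(x) y/κ)`
  have hs : HasFDerivAt (fun p : 𝔼 2 => sFun k (p 0)) (sD k (p 0) • X0) p :=
    hasFDerivAt_comp_X0 (hasDerivAt_sFun k (p 0))
  have hprod : HasFDerivAt (fun p : 𝔼 2 => sFun k (p 0) * p 1)
      (sFun k (p 0) • X1 + p 1 • (sD k (p 0) • X0)) p :=
    hs.mul (X1.hasFDerivAt (x := p))
  have hin : HasFDerivAt (fun p : 𝔼 2 => 4 * sFun k (p 0) * p 1 / P.κ)
      ((4 / P.κ) • (sFun k (p 0) • X1 + p 1 • (sD k (p 0) • X0))) p := by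
    have e : (fun p : 𝔼 2 => 4 * sFun k (p 0) * p 1 / P.κ) =
        fun p : 𝔼 2 => (4 / P.κ) * (sFun k (p 0) * p 1) := by
      funext q; ring
    rw [e]
    exact hprod.const_mul (4 / P.κ)
  have h6 : HasFDerivAt (fun p : 𝔼 2 => P.κ / 2 * smoothAbs (4 * sFun k (p 0) * p 1 / P.κ))
      ((P.κ / 2) • (smoothSign (4 * sFun k (p 0) * p 1 / P.κ) •
        ((4 / P.κ) • (sFun k (p 0) • X1 + p 1 • (sD k (p 0) • X0))))) p :=
    ((hasDerivAt_smoothAbs _).comp_hasFDerivAt p hin).const_mul (P.κ / 2)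
  have hsum := ((((((h1.add h2).add h3).add h4).add h5).sub h6).add h7).add h8
  have hfun : P.ladder = fun p : 𝔼 2 => P.τ * p 0 + barrier (-p 0) + barrier (p 0 - xR k) +
      p 1 ^ 2 + sFun k (p 0) ^ 2 - P.κ / 2 * smoothAbs (4 * sFun k (p 0) * p 1 / P.κ) +
      barrier (p 1 - 2) + barrier (-p 1 - 2) := rfl
  rw [hfun]
  refine hsum.congr_fderiv ?_
  have hκ : P.κ ≠ 0 := P.κ_pos.ne'
  ext v
  simp only [ladderD_apply, dX, dY, _root_.add_apply, _root_.sub_apply,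
    FunLike.coe_smul, Pi.smul_apply, X0_apply, X1_apply, smul_eq_mul]
  field_simp
  ring

/-- `fderiv q = dq`. [folklore] -/
theorem fderiv_ladder (p : 𝔼 2) : fderiv ℝ P.ladder p = P.ladderD p := (P.hasFDerivAt_ladder p).fderiv

/-- **Critical points**: `p` is critical iff `∂q/∂x = 0` and `∂q/∂y = 0` there. [folklore] -/
theorem isMCriticalPt_iff (p : 𝔼 2) :
    IsMCriticalPt (𝓡 2) P.ladder p ↔ P.dX (p 0) (p 1) = 0 ∧ P.dY (p 0) (p 1) = 0 := by
  rw [MorseBirth.isMCriticalPt_iff_fderiv, fderiv_ladder]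
  constructor
  · intro h
    have e0 := congrArg (fun L : 𝔼 2 →L[ℝ] ℝ => L (EuclideanSpace.single 0 1)) h
    have e1 := congrArg (fun L : 𝔼 2 →L[ℝ] ℝ => L (EuclideanSpace.single 1 1)) h
    simp at e0 e1
    exact ⟨e0, e1⟩
  · rintro ⟨h0, h1⟩
    ext v
    simp [h0, h1]

/-! ### §5 The sign of `s'` and the product formula for `(s²)'` -/

/-- `s`, the smooth step, and `u` as differentiable functions: the product rule for
`s² = smoothStep² · u`. [folklore] -/
theorem two_mul_sFun_mul_sD (x : ℝ) :
    2 * sFun k x * sD k x =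
      2 * smoothStep 0 1 x * deriv (smoothStep 0 1) x * uCell k x +
        smoothStep 0 1 x ^ 2 * (-2 * ∑ i ∈ Finset.range k, dbump (x - ctr i)) := by
  -- both sides are the derivative of `x ↦ s(x)²`
  have h1 : HasDerivAt (fun x => sFun k x ^ 2) (↑(2 : ℕ) * sFun k x ^ (2 - 1) * sD k x) x :=
    (hasDerivAt_sFun k x).pow 2
  have hst : HasDerivAt (smoothStep 0 1) (deriv (smoothStep 0 1) x) x :=
    ((contDiff_smoothStep 0 1).differentiable (by simp) x).hasDerivAt
  have h2 : HasDerivAt (fun x => smoothStep 0 1 x ^ 2 * uCell k x)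
      (↑(2 : ℕ) * smoothStep 0 1 x ^ (2 - 1) * deriv (smoothStep 0 1) x * uCell k x +
        smoothStep 0 1 x ^ 2 * (-2 * ∑ i ∈ Finset.range k, dbump (x - ctr i))) x :=
    (hst.pow 2).mul (hasDerivAt_uCell k x)
  have hfun : (fun x => sFun k x ^ 2) = fun x => smoothStep 0 1 x ^ 2 * uCell k x := by
    funext x
    unfold sFun
    rw [mul_pow, Real.sq_sqrt (uCell_pos k x).le]
  rw [hfun] at h1
  have := h1.unique h2
  norm_num at this
  linarith

/-- `s' = 0` for `x < 0`. [folklore] -/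
theorem sD_of_neg {x : ℝ} (hx : x < 0) : sD k x = 0 := by
  unfold sD
  have : sFun k =ᶠ[𝓝 x] fun _ => 0 :=
    eventuallyEq_of_mem (Iio_mem_nhds hx) fun y hy => sFun_of_nonpos (le_of_lt hy)
  rw [this.deriv_eq, deriv_const]

/-- `s'(0) = 0`. [folklore] -/
theorem sD_zero : sD k 0 = 0 := by
  have h := two_mul_sFun_mul_sD (k := k) 0
  rw [smoothStep_of_le zero_lt_one le_rfl, deriv_smoothStep_left] at h
  -- `h : 2 * s(0) * sD 0 = 0` is useless since `s(0) = 0`; use the product rule for `s` itself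
  unfold sD
  have hst : HasDerivAt (smoothStep 0 1) (deriv (smoothStep 0 1) 0) 0 :=
    ((contDiff_smoothStep 0 1).differentiable (by simp) 0).hasDerivAt
  have hsq : HasDerivAt (fun x => Real.sqrt (uCell k x)) (deriv (fun x => Real.sqrt (uCell k x)) 0) 0 :=
    (((contDiff_uCell k).sqrt fun x => (uCell_pos k x).ne').differentiable (by simp) 0).hasDerivAt
  have hprod : HasDerivAt (fun x => smoothStep 0 1 x * Real.sqrt (uCell k x))
      (deriv (smoothStep 0 1) 0 * Real.sqrt (uCell k 0) +
        smoothStep 0 1 0 * deriv (fun x => Real.sqrt (uCell k x)) 0) 0 := hst.mul hsq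
  have e : sFun k = fun x => smoothStep 0 1 x * Real.sqrt (uCell k x) := rfl
  rw [e, hprod.deriv, deriv_smoothStep_left, smoothStep_of_le zero_lt_one le_rfl]
  ring

/-- `s' = 0` for `x ≤ 0`. [folklore] -/
theorem sD_of_nonpos {x : ℝ} (hx : x ≤ 0) : sD k x = 0 := by
  rcases hx.eq_or_lt with h | h
  · rw [h]; exact sD_zero
  · exact sD_of_neg h

/-- `b' > 0` happens only on `(-1, 0)`. [folklore] -/
theorem mem_Ioo_of_dbump_pos {t : ℝ} (h : 0 < dbump t) : t ∈ Ioo (-1) 0 := by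
  have ht0 : t < 0 := by
    by_contra h'
    exact absurd (dbump_nonpos (not_lt.1 h')) (not_le.2 h)
  refine ⟨?_, ht0⟩
  by_contra h'
  rw [dbump_eq_zero (by rw [abs_of_neg ht0]; linarith)] at h
  exact lt_irrefl _ h

/-- **Where `s' < 0`**: only in the left half of a cell. [folklore] -/
theorem exists_cell_of_sD_neg {x : ℝ} (h : sD k x < 0) : ∃ i < k, x - ctr i ∈ Ioo (-1) 0 := by
  have hx : 0 < x := by
    by_contra h'
    rw [sD_of_nonpos (not_lt.1 h')] at h
    exact lt_irrefl _ h
  have hs : 0 < sFun k x := by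
    unfold sFun
    rcases le_or_gt 1 x with h1 | h1
    · rw [smoothStep_of_ge zero_lt_one h1, one_mul]; exact Real.sqrt_pos.2 (uCell_pos k x)
    · exact mul_pos (smoothStep_mem_Ioo zero_lt_one ⟨hx, h1⟩).1 (Real.sqrt_pos.2 (uCell_pos k x))
  have hprod := two_mul_sFun_mul_sD (k := k) x
  have hneg : 2 * sFun k x * sD k x < 0 := by nlinarith
  have ht1 : 0 ≤ 2 * smoothStep 0 1 x * deriv (smoothStep 0 1) x * uCell k x :=
    mul_nonneg (mul_nonneg (mul_nonneg two_pos.le (smoothStep_mem_Icc 0 1 x).1)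
      (deriv_smoothStep_nonneg zero_lt_one x)) (uCell_pos k x).le
  have hsum : 0 < ∑ i ∈ Finset.range k, dbump (x - ctr i) := by
    nlinarith [sq_nonneg (smoothStep 0 1 x), (smoothStep_mem_Icc 0 1 x).2]
  obtain ⟨i, hi, hpos⟩ := Finset.exists_lt_of_sum_lt (s := Finset.range k) (f := fun _ => (0 : ℝ))
    (g := fun i => dbump (x - ctr i)) (by simpa using hsum)
  exact ⟨i, Finset.mem_range.1 hi, mem_Ioo_of_dbump_pos hpos⟩

/-- **In the left half of the `i`-th cell** `2 s s' = -2 b'(x - ctr i)` (there the smooth step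
is `1`, flat, and only the `i`-th bump is alive). [folklore] -/
theorem two_mul_sFun_mul_sD_cell {i : ℕ} (hi : i < k) {x : ℝ} (hx : |x - ctr i| < 1) :
    2 * sFun k x * sD k x = -2 * dbump (x - ctr i) := by
  have hlt := abs_lt.1 hx
  have hi0 : (0 : ℝ) ≤ i := Nat.cast_nonneg i
  have hx1 : 1 < x := by unfold ctr at hlt; linarith
  rw [two_mul_sFun_mul_sD, smoothStep_of_ge zero_lt_one hx1.le, deriv_smoothStep_of_gt zero_lt_one hx1,
    sum_dbump_eq_of_pos hi (bump_pos hx)]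
  ring

/-! ### §6 The critical set -/

/-- The two roots `x₁ < x₂` of `b' = τ/2` (`exists_two_roots_dbump`). [folklore] -/
theorem roots_spec : ∃ x₁ x₂ : ℝ, x₁ ∈ Ioo (-1) (-xStar) ∧ x₂ ∈ Ioo (-1 / 2) 0 ∧
    dbump x₁ = P.τ / 2 ∧ dbump x₂ = P.τ / 2 ∧ 0 < deriv dbump x₁ ∧ deriv dbump x₂ < 0 ∧
      ∀ x, dbump x = P.τ / 2 → x = x₁ ∨ x = x₂ :=
  exists_two_roots_dbump (half_pos P.τ_pos) P.τ_lt

/-- The abscissa (relative to the cell centre) of the hole maxima. [folklore] -/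
def x₁ : ℝ := P.roots_spec.choose

/-- The abscissa (relative to the cell centre) of the rung saddles. [folklore] -/
def x₂ : ℝ := P.roots_spec.choose_spec.choose

/-- `x₁ ∈ (-1, -x⋆)`. [folklore] -/
theorem x₁_mem : P.x₁ ∈ Ioo (-1) (-xStar) := P.roots_spec.choose_spec.choose_spec.1
/-- `x₂ ∈ (-1/2, 0)`. [folklore] -/
theorem x₂_mem : P.x₂ ∈ Ioo (-1 / 2) 0 := P.roots_spec.choose_spec.choose_spec.2.1
/-- `b'(x₁) = τ/2`. [folklore] -/
theorem dbump_x₁ : dbump P.x₁ = P.τ / 2 := P.roots_spec.choose_spec.choose_spec.2.2.1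
/-- `b'(x₂) = τ/2`. [folklore] -/
theorem dbump_x₂ : dbump P.x₂ = P.τ / 2 := P.roots_spec.choose_spec.choose_spec.2.2.2.1
/-- `b''(x₁) > 0`. [folklore] -/
theorem deriv_dbump_x₁_pos : 0 < deriv dbump P.x₁ := P.roots_spec.choose_spec.choose_spec.2.2.2.2.1
/-- `b''(x₂) < 0`. [folklore] -/
theorem deriv_dbump_x₂_neg : deriv dbump P.x₂ < 0 := P.roots_spec.choose_spec.choose_spec.2.2.2.2.2.1
/-- `x₁, x₂` are the only roots of `b' = τ/2`. [folklore] -/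
theorem eq_x₁_or_eq_x₂ {x : ℝ} (h : dbump x = P.τ / 2) : x = P.x₁ ∨ x = P.x₂ :=
  P.roots_spec.choose_spec.choose_spec.2.2.2.2.2.2 x h

/-- `|x₁| < 1` and `|x₂| < 1`. [folklore] -/
theorem abs_x₁_lt : |P.x₁| < 1 := by
  have h := P.x₁_mem; rw [abs_lt]; exact ⟨h.1, by linarith [h.2, xStar_pos]⟩
/-- `|x₂| < 1`. [folklore] -/
theorem abs_x₂_lt : |P.x₂| < 1 := by
  have h := P.x₂_mem; rw [abs_lt]; exact ⟨by linarith [h.1], by linarith [h.2]⟩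

/-- The root `t₀` of `p' = τ` (`exists_unique_root_deriv_barrier`). [folklore] -/
theorem t₀_spec : ∃ t₀ : ℝ, 0 < t₀ ∧ deriv barrier t₀ = P.τ ∧ 0 < deriv (deriv barrier) t₀ ∧
    ∀ t, deriv barrier t = P.τ → t = t₀ :=
  exists_unique_root_deriv_barrier P.τ_pos

/-- The abscissa `-t₀` of the minimum is `-P.t₀`. [folklore] -/
def t₀ : ℝ := P.t₀_spec.choose

/-- `t₀ > 0`. [folklore] -/
theorem t₀_pos : 0 < P.t₀ := P.t₀_spec.choose_spec.1
/-- `p'(t₀) = τ`. [folklore] -/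
theorem deriv_barrier_t₀ : deriv barrier P.t₀ = P.τ := P.t₀_spec.choose_spec.2.1
/-- `p''(t₀) > 0`. [folklore] -/
theorem deriv_deriv_barrier_t₀_pos : 0 < deriv (deriv barrier) P.t₀ := P.t₀_spec.choose_spec.2.2.1
/-- `t₀` is the only root of `p' = τ`. [folklore] -/
theorem eq_t₀ {t : ℝ} (h : deriv barrier t = P.τ) : t = P.t₀ := P.t₀_spec.choose_spec.2.2.2 t h

/-- `∂q/∂y` off the band `|y| ≤ 2` does not vanish. [folklore] -/
theorem dY_ne_zero_of_two_lt {x y : ℝ} (hy : 2 < |y|) : P.dY x y ≠ 0 := by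
  unfold dY
  have hσ := abs_smoothSign_le_one (4 * sFun k x * y / P.κ)
  have hs0 := sFun_nonneg k x
  have hs1 := sFun_le_one k x
  have hbd : |sFun k x * smoothSign (4 * sFun k x * y / P.κ)| ≤ 1 := by
    rw [abs_mul, abs_of_nonneg hs0]
    calc sFun k x * |smoothSign (4 * sFun k x * y / P.κ)| ≤ 1 * 1 := by gcongr
      _ = 1 := one_mul 1
  have hb := abs_le.1 hbd
  rcases le_or_gt y 0 with h | h
  · rw [abs_of_nonpos h] at hy
    rw [deriv_barrier_of_nonpos (by linarith : y - 2 ≤ 0)]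
    have := deriv_barrier_nonneg (-y - 2)
    linarith
  · rw [abs_of_pos h] at hy
    rw [deriv_barrier_of_nonpos (by linarith : -y - 2 ≤ 0)]
    have := deriv_barrier_nonneg (y - 2)
    linarith

/-- `∂q/∂y` in the band `|y| ≤ 2`. [folklore] -/
theorem dY_of_abs_le {x y : ℝ} (hy : |y| ≤ 2) :
    P.dY x y = 2 * y - 2 * sFun k x * smoothSign (4 * sFun k x * y / P.κ) := by
  unfold dY
  have h := abs_le.1 hy
  rw [deriv_barrier_of_nonpos (by linarith : y - 2 ≤ 0),
    deriv_barrier_of_nonpos (by linarith : -y - 2 ≤ 0)]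
  ring

/-- **No side branches.**  If `y = s σ(t)`, `t = 4sy/κ`, with `|t| < 1`, `s² ≥ u_min` and
`0 ≤ s`, then `y = 0`: indeed `t = (4s²/κ) σ(t)` with `4s² m₀/κ > 1` and `σ(t) ≥ m₀ t` on
`[0, 1]` (oddly on `[-1, 0]`), which forces `t = 0`. [folklore] -/
theorem eq_zero_of_eq_mul_smoothSign {s y : ℝ} (hs0 : 0 ≤ s) (hs : 1 - 2 * bump 0 ≤ s ^ 2)
    (h : y = s * smoothSign (4 * s * y / P.κ)) (ht1 : |4 * s * y / P.κ| < 1) : y = 0 := by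
  have hκ := P.κ_pos
  have hm := P.m₀_pos
  have hu := uMin_pos
  have hspos : 0 < s := by
    rcases hs0.eq_or_lt with h0 | h0
    · rw [← h0] at hs; norm_num at hs; linarith
    · exact h0
  set t := 4 * s * y / P.κ with ht
  set A := 4 * s ^ 2 / P.κ with hA
  have hApos : 0 < A := by positivity
  -- `t = A σ(t)`
  have key : t = A * smoothSign t := by
    calc t = 4 * s * y / P.κ := ht
      _ = 4 * s * (s * smoothSign t) / P.κ := by rw [← h]
      _ = A * smoothSign t := by rw [hA]; ring
  have hbig : 1 < A * P.m₀ := by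
    rw [hA, div_mul_eq_mul_div, one_lt_div hκ]
    calc P.κ < 4 * (1 - 2 * bump 0) * P.m₀ := P.κ_lt
      _ ≤ 4 * s ^ 2 * P.m₀ := by gcongr
  have htlt := abs_lt.1 ht1
  -- sign analysis of `t`
  have ht0 : t = 0 := by
    by_contra hne
    rcases lt_or_gt_of_ne hne with hlt | hgt
    · have hσ : smoothSign t ≤ P.m₀ * t := by
        have := P.m₀_slope (-t) ⟨by linarith, by linarith⟩
        rw [smoothSign_neg] at this
        linarith
      have h1 : A * smoothSign t ≤ A * (P.m₀ * t) := mul_le_mul_of_nonneg_left hσ hApos.le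
      have h2 : t ≤ (A * P.m₀) * t :=
        calc t = A * smoothSign t := key
          _ ≤ A * (P.m₀ * t) := h1
          _ = (A * P.m₀) * t := by ring
      have h3 : 0 < (A * P.m₀ - 1) * (-t) := mul_pos (by linarith) (by linarith)
      nlinarith
    · have hσ : P.m₀ * t ≤ smoothSign t := P.m₀_slope t ⟨hgt.le, by linarith⟩
      have h1 : A * (P.m₀ * t) ≤ A * smoothSign t := mul_le_mul_of_nonneg_left hσ hApos.le
      have h2 : (A * P.m₀) * t ≤ t :=
        calc (A * P.m₀) * t = A * (P.m₀ * t) := by ring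
          _ ≤ A * smoothSign t := h1
          _ = t := key.symm
      have h3 : 0 < (A * P.m₀ - 1) * t := mul_pos (by linarith) hgt
      nlinarith
  have h4 : 4 * s * y = 0 := by
    have := congrArg (· * P.κ) ht0
    simp only [zero_mul] at this
    rwa [ht, div_mul_cancel₀ _ hκ.ne'] at this
  rcases mul_eq_zero.1 h4 with h' | h'
  · nlinarith
  · exact h'

/-- `pt` determines a point from its coordinates. [folklore] -/
theorem eq_pt_iff {p : 𝔼 2} {a b : ℝ} : p = pt a b ↔ p 0 = a ∧ p 1 = b := by
  constructor
  · rintro rfl; exact ⟨rfl, rfl⟩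
  · rintro ⟨h0, h1⟩
    rw [← pt_eta p, h0, h1]

/-- The cell points lie in `(1, x_R)` with `|x - ctr i| < 1`: bookkeeping. [folklore] -/
theorem ctr_add_mem {i : ℕ} (hi : i < k) {ξ : ℝ} (hξ : |ξ| < 1) :
    1 < ctr i + ξ ∧ ctr i + ξ < xR k ∧ |ctr i + ξ - ctr i| < 1 := by
  have h := abs_lt.1 hξ
  have hi0 : (0 : ℝ) ≤ i := Nat.cast_nonneg i
  have hik : (i : ℝ) + 1 ≤ k := by exact_mod_cast hi
  unfold ctr xR
  refine ⟨by linarith, by linarith, ?_⟩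
  rw [show 4 * (i : ℝ) + 4 + ξ - (4 * i + 4) = ξ by ring]
  exact hξ

/-- `∂q/∂x` and `∂q/∂y` at a cell point `(ctr i + ξ, 0)`, `|ξ| < 1`:
`∂q/∂x = τ - 2 b'(ξ)`, `∂q/∂y = 0`. [folklore] -/
theorem dX_dY_cell {i : ℕ} (hi : i < k) {ξ : ℝ} (hξ : |ξ| < 1) :
    P.dX (ctr i + ξ) 0 = P.τ - 2 * dbump ξ ∧ P.dY (ctr i + ξ) 0 = 0 := by
  obtain ⟨h1, h2, h3⟩ := ctr_add_mem hi hξ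
  have hcell := two_mul_sFun_mul_sD_cell hi h3
  rw [show ctr i + ξ - ctr i = ξ by ring] at hcell
  constructor
  · unfold dX
    rw [deriv_barrier_of_nonpos (by linarith : -(ctr i + ξ) ≤ 0),
      deriv_barrier_of_nonpos (by linarith : ctr i + ξ - xR k ≤ 0)]
    simp only [zero_mul, mul_zero, zero_div, sub_zero]
    linarith
  · rw [P.dY_of_abs_le (by norm_num)]
    simp [smoothSign_zero]

/-- `∂q/∂x` and `∂q/∂y` at the cap point `(-t₀, 0)`: both vanish. [folklore] -/
theorem dX_dY_cap : P.dX (-P.t₀) 0 = 0 ∧ P.dY (-P.t₀) 0 = 0 := by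
  have ht := P.t₀_pos
  constructor
  · unfold dX
    rw [neg_neg, P.deriv_barrier_t₀, sD_of_nonpos (by linarith),
      deriv_barrier_of_nonpos (by unfold xR; have : (0:ℝ) ≤ k := Nat.cast_nonneg k; linarith)]
    ring
  · rw [P.dY_of_abs_le (by norm_num), sFun_of_nonpos (by linarith)]
    simp

/-- **The critical points of the ladder.**  A point is critical iff it is the minimum
`(-t₀, 0)` or one of the `2k` cell points `(ctr i + x₁, 0)`, `(ctr i + x₂, 0)`, `i < k`.
[folklore] -/
theorem isMCriticalPt_iff_mem (p : 𝔼 2) :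
    IsMCriticalPt (𝓡 2) P.ladder p ↔
      p = pt (-P.t₀) 0 ∨ ∃ i < k, p = pt (ctr i + P.x₁) 0 ∨ p = pt (ctr i + P.x₂) 0 := by
  rw [P.isMCriticalPt_iff]
  constructor
  · rintro ⟨hX, hY⟩
    set x := p 0 with hxdef
    set y := p 1 with hydef
    have hτ := P.τ_pos
    -- the band `|y| ≤ 2` and the equation `y = s σ(t)`
    have hy2 : |y| ≤ 2 := by
      by_contra h
      exact P.dY_ne_zero_of_two_lt (not_le.1 h) hY
    rw [P.dY_of_abs_le hy2] at hY
    have hyeq : y = sFun k x * smoothSign (4 * sFun k x * y / P.κ) := by linarith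
    rcases le_or_gt x 0 with hx0 | hx0
    · -- left cap: `s = 0`, so `y = 0`, and `p'(-x) = τ`
      left
      have hs : sFun k x = 0 := sFun_of_nonpos hx0
      have hy0 : y = 0 := by rw [hyeq, hs, zero_mul]
      have hk0 : (0 : ℝ) ≤ k := Nat.cast_nonneg k
      have hX' : deriv barrier (-x) = P.τ := by
        unfold dX at hX
        rw [sD_of_nonpos hx0, deriv_barrier_of_nonpos (t := x - xR k) (by unfold xR; linarith)] at hX
        linarith
      have hxt : -x = P.t₀ := P.eq_t₀ hX'
      rw [eq_pt_iff]
      exact ⟨by linarith, hy0⟩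
    · -- right of the cap: `p'(-x) = 0`, and `s' < 0` is forced
      right
      set σ := smoothSign (4 * sFun k x * y / P.κ) with hσdef
      have hfac : sFun k x - y * σ = sFun k x * (1 - σ ^ 2) := by
        conv_lhs => rw [hyeq]
        ring
      have hσ2 : σ ^ 2 ≤ 1 := smoothSign_sq_le_one _
      have hs0 := sFun_nonneg k x
      have hnn : 0 ≤ sFun k x * (1 - σ ^ 2) := mul_nonneg hs0 (by linarith)
      have hpb : 0 ≤ deriv barrier (x - xR k) := deriv_barrier_nonneg _
      unfold dX at hX
      rw [deriv_barrier_of_nonpos (by linarith : -x ≤ 0), hfac] at hX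
      -- `2 s' · s(1 - σ²) = -(τ + p'(x - x_R)) < 0`, hence `s' < 0` and `s(1 - σ²) > 0`
      have hprod : sD k x * (sFun k x * (1 - σ ^ 2)) < 0 := by nlinarith
      have hsD : sD k x < 0 := by
        by_contra h
        have := mul_nonneg (not_lt.1 h) hnn
        linarith
      have hpos : 0 < sFun k x * (1 - σ ^ 2) := by
        by_contra h
        have h' : sFun k x * (1 - σ ^ 2) = 0 := le_antisymm (not_lt.1 h) hnn
        rw [h'] at hprod; simp at hprod
      obtain ⟨i, hi, hcell⟩ := exists_cell_of_sD_neg hsD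
      refine ⟨i, hi, ?_⟩
      have hi0 : (0 : ℝ) ≤ i := Nat.cast_nonneg i
      have hik : (i : ℝ) + 1 ≤ k := by exact_mod_cast hi
      have hxR : x < xR k := by unfold xR; unfold ctr at hcell; linarith [hcell.2]
      have hx1 : 1 ≤ x := by unfold ctr at hcell; linarith [hcell.1]
      rw [deriv_barrier_of_nonpos (by linarith : x - xR k ≤ 0)] at hX
      -- `|t| < 1`, so no side branch: `y = 0`
      have hσlt : σ ^ 2 < 1 := by
        by_contra h
        have : σ ^ 2 = 1 := le_antisymm hσ2 (not_lt.1 h)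
        rw [this] at hpos; simp at hpos
      have ht1 : |4 * sFun k x * y / P.κ| < 1 := by
        by_contra h
        have := smoothSign_sq_eq_one (not_lt.1 h)
        rw [← hσdef] at this
        linarith
      have hy0 : y = 0 :=
        P.eq_zero_of_eq_mul_smoothSign hs0 (uMin_le_sFun_sq hx1) hyeq ht1
      -- then `σ = 0` and `τ = 2 b'(x - ctr i)`
      have hσ0 : σ = 0 := by rw [hσdef, hy0]; simp [smoothSign_zero]
      have habs : |x - ctr i| < 1 := by rw [abs_lt]; exact ⟨hcell.1, by linarith [hcell.2]⟩
      have h2 := two_mul_sFun_mul_sD_cell hi habs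
      rw [hσ0] at hX
      have hdb : dbump (x - ctr i) = P.τ / 2 := by nlinarith
      rcases P.eq_x₁_or_eq_x₂ hdb with h | h
      · left; rw [eq_pt_iff]; exact ⟨by linarith, hy0⟩
      · right; rw [eq_pt_iff]; exact ⟨by linarith, hy0⟩
  · rintro (rfl | ⟨i, hi, rfl | rfl⟩)
    · simpa using P.dX_dY_cap
    · have h := P.dX_dY_cell hi P.abs_x₁_lt
      rw [P.dbump_x₁] at h
      simp only [pt_apply_zero, pt_apply_one]
      exact ⟨by linarith [h.1], h.2⟩
    · have h := P.dX_dY_cell hi P.abs_x₂_lt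
      rw [P.dbump_x₂] at h
      simp only [pt_apply_zero, pt_apply_one]
      exact ⟨by linarith [h.1], h.2⟩

/-- The critical set, as a finite union. [folklore] -/
theorem criticalSet_eq :
    criticalSet (𝓡 2) P.ladder =
      {pt (-P.t₀) 0} ∪ ⋃ i ∈ Finset.range k, {pt (ctr i + P.x₁) 0, pt (ctr i + P.x₂) 0} := by
  ext p
  simp only [criticalSet, mem_setOf_eq, P.isMCriticalPt_iff_mem, mem_union, mem_singleton_iff,
    mem_iUnion, Finset.mem_range, mem_insert_iff, exists_prop]

/-- The critical set is finite. [folklore] -/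
theorem finite_criticalSet : (criticalSet (𝓡 2) P.ladder).Finite := by
  rw [criticalSet_eq]
  exact (finite_singleton _).union (Finset.finite_toSet _ |>.biUnion fun i _ =>
    (finite_singleton _).insert _)

/-! ### §7 The Hessian at the critical points -/

/-- The basis vector `(1, 0)`. [folklore] -/
abbrev e0 : 𝔼 2 := EuclideanSpace.single 0 1

/-- The basis vector `(0, 1)`. [folklore] -/
abbrev e1 : 𝔼 2 := EuclideanSpace.single 1 1

/-- `v = v₀ (1, 0) + v₁ (0, 1)`. [folklore] -/
theorem eq_smul_add_smul (v : 𝔼 2) : v = v 0 • e0 + v 1 • e1 := by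
  ext i; fin_cases i <;> simp

/-- Moving along the axis: `pt a 0 + t (1, 0) = pt (a + t) 0`, coordinates. [folklore] -/
theorem pt_add_smul_e0 (a t : ℝ) : (pt a 0 + t • e0) 0 = a + t ∧ (pt a 0 + t • e0) 1 = 0 := by
  constructor <;> simp

/-- Moving off the axis: `pt a 0 + t (0, 1)`, coordinates. [folklore] -/
theorem pt_add_smul_e1 (a t : ℝ) : (pt a 0 + t • e1) 0 = a ∧ (pt a 0 + t • e1) 1 = t := by
  constructor <;> simp

/-- `U = s²`: its derivative is `2 s s'`. [folklore] -/
theorem deriv_sFun_sq (x : ℝ) : deriv (fun x => sFun k x ^ 2) x = 2 * sFun k x * sD k x := by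
  have h : HasDerivAt (fun x => sFun k x ^ 2) (↑(2 : ℕ) * sFun k x ^ (2 - 1) * sD k x) x :=
    (hasDerivAt_sFun k x).pow 2
  rw [h.deriv]; norm_num

/-- `x ↦ s(x)²` is smooth. [folklore] -/
theorem contDiff_sFun_sq : ContDiff ℝ ∞ (fun x => sFun k x ^ 2) := (contDiff_sFun k).pow 2

/-- **Along the axis, `∂q/∂x (a + t, 0) = τ - p'(-a-t) + p'(a+t-x_R) + (s²)'(a + t)`.**
[folklore] -/
theorem dX_axis (a t : ℝ) :
    P.dX (a + t) 0 = P.τ - deriv barrier (-(a + t)) + deriv barrier (a + t - xR k) +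
      deriv (fun x => sFun k x ^ 2) (a + t) := by
  unfold dX; rw [deriv_sFun_sq]; ring

/-- `∂q/∂y (x, 0) = 0` for every `x`. [folklore] -/
theorem dY_axis (x : ℝ) : P.dY x 0 = 0 := by
  rw [P.dY_of_abs_le (by norm_num)]; simp [smoothSign_zero]

/-- `p'' = 6·smoothTransition`. [folklore] -/
theorem deriv_deriv_barrier (t : ℝ) : deriv (deriv barrier) t = 6 * smoothTransition t :=
  (hasDerivAt_deriv_barrier t).deriv

/-- The `xx`-entry of the Hessian on the axis: `6 T(-a) + 6 T(a - x_R) + (s²)''(a)`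
(`T = smoothTransition`). [folklore] -/
def hXX (a : ℝ) : ℝ :=
  6 * smoothTransition (-a) + 6 * smoothTransition (a - xR k) +
    deriv (deriv (fun x => sFun k x ^ 2)) a

/-- The `yy`-entry of the Hessian on the axis: `2 - 8 s(a)² σ'(0)/κ`. [folklore] -/
def hYY (a : ℝ) : ℝ := 2 - 8 * sFun k a ^ 2 * deriv smoothSign 0 / P.κ

/-- **`D²q (1,0)(1,0)` at `(a, 0)` is `hXX a`.** [folklore] -/
theorem hessian_xx (a : ℝ) : fderiv ℝ (fderiv ℝ P.ladder) (pt a 0) e0 e0 = hXX (k := k) a := by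
  have h1 := FlowerModel.hasDerivAt_fderiv_line (P.contDiff_ladder.of_le (by norm_cast)) (pt a 0) e0 e0
  have hfun : (fun t : ℝ => fderiv ℝ P.ladder (pt a 0 + t • e0) e0) = fun t =>
      P.τ - deriv barrier (-(a + t)) + deriv barrier (a + t - xR k) +
        deriv (fun x => sFun k x ^ 2) (a + t) := by
    funext t
    rw [fderiv_ladder, ladderD_apply, (pt_add_smul_e0 a t).1, (pt_add_smul_e0 a t).2, dX_axis]
    simp
  rw [hfun] at h1
  have hl : HasDerivAt (fun t : ℝ => a + t) 1 0 := by simpa using (hasDerivAt_id (0:ℝ)).const_add a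
  have hb1 : HasDerivAt (fun t : ℝ => deriv barrier (-(a + t)))
      (deriv (deriv barrier) (-(a + 0)) * -1) 0 :=
    (hasDerivAt_deriv_barrier _ |>.congr_deriv (deriv_deriv_barrier _).symm).comp 0 hl.neg
  have hb2 : HasDerivAt (fun t : ℝ => deriv barrier (a + t - xR k))
      (deriv (deriv barrier) (a + 0 - xR k) * 1) 0 :=
    (hasDerivAt_deriv_barrier _ |>.congr_deriv (deriv_deriv_barrier _).symm).comp 0 (hl.sub_const _)
  have hUd : ContDiff ℝ ∞ (deriv fun x => sFun k x ^ 2) := (contDiff_infty_iff_deriv.1 contDiff_sFun_sq).2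
  have hU : HasDerivAt (fun t : ℝ => deriv (fun x => sFun k x ^ 2) (a + t))
      (deriv (deriv fun x => sFun k x ^ 2) (a + 0) * 1) 0 :=
    ((hUd.differentiable (by simp)) _).hasDerivAt.comp 0 hl
  have h2 := (((hasDerivAt_const (0:ℝ) P.τ).sub hb1).add hb2).add hU
  have := h1.unique h2
  rw [this]
  unfold hXX
  simp only [add_zero, deriv_deriv_barrier]
  ring

/-- **`D²q (0,1)(1,0)` at `(a, 0)` vanishes.** [folklore] -/
theorem hessian_xy (a : ℝ) : fderiv ℝ (fderiv ℝ P.ladder) (pt a 0) e1 e0 = 0 := by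
  have h1 := FlowerModel.hasDerivAt_fderiv_line (P.contDiff_ladder.of_le (by norm_cast)) (pt a 0) e1 e0
  set c : ℝ := 4 * sFun k a / P.κ with hc
  have hfun : (fun t : ℝ => fderiv ℝ P.ladder (pt a 0 + t • e1) e0) = fun t =>
      (P.τ - deriv barrier (-a) + deriv barrier (a - xR k) + 2 * sD k a * sFun k a) -
        2 * sD k a * (t * smoothSign (c * t)) := by
    funext t
    have e00 : e0 0 = 1 := by simp [e0]
    have e01 : e0 1 = 0 := by simp [e0]
    rw [fderiv_ladder, ladderD_apply, (pt_add_smul_e1 a t).1, (pt_add_smul_e1 a t).2]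
    simp only [e00, e01, mul_one, mul_zero, add_zero, dX, hc]
    ring_nf
  rw [hfun] at h1
  have hσ : HasDerivAt (fun t : ℝ => t * smoothSign (c * t)) (1 * smoothSign (c * 0) +
      0 * (deriv smoothSign (c * 0) * (c * 1))) 0 :=
    (hasDerivAt_id 0).mul ((hasDerivAt_smoothSign (c * 0)).comp 0 ((hasDerivAt_id 0).const_mul c))
  have h2 := (hasDerivAt_const (0:ℝ) (P.τ - deriv barrier (-a) + deriv barrier (a - xR k) +
    2 * sD k a * sFun k a)).sub (hσ.const_mul (2 * sD k a))
  have := h1.unique h2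
  rw [this]
  simp [smoothSign_zero]

/-- **`D²q (1,0)(0,1)` at `(a, 0)` vanishes** (`∂q/∂y ≡ 0` on the axis). [folklore] -/
theorem hessian_yx (a : ℝ) : fderiv ℝ (fderiv ℝ P.ladder) (pt a 0) e0 e1 = 0 := by
  have h1 := FlowerModel.hasDerivAt_fderiv_line (P.contDiff_ladder.of_le (by norm_cast)) (pt a 0) e0 e1
  have hfun : (fun t : ℝ => fderiv ℝ P.ladder (pt a 0 + t • e0) e1) = fun _ => 0 := by
    funext t
    rw [fderiv_ladder, ladderD_apply, (pt_add_smul_e0 a t).1, (pt_add_smul_e0 a t).2, dY_axis]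
    simp
  rw [hfun] at h1
  exact h1.unique (hasDerivAt_const (0:ℝ) (0:ℝ))

/-- **`D²q (0,1)(0,1)` at `(a, 0)` is `hYY a`.** [folklore] -/
theorem hessian_yy (a : ℝ) : fderiv ℝ (fderiv ℝ P.ladder) (pt a 0) e1 e1 = P.hYY a := by
  have h1 := FlowerModel.hasDerivAt_fderiv_line (P.contDiff_ladder.of_le (by norm_cast)) (pt a 0) e1 e1
  set s₀ : ℝ := sFun k a with hs₀
  set c : ℝ := 4 * s₀ / P.κ with hc
  have hfun : (fun t : ℝ => fderiv ℝ P.ladder (pt a 0 + t • e1) e1) = fun t =>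
      2 * t - 2 * s₀ * smoothSign (c * t) + deriv barrier (t - 2) - deriv barrier (-t - 2) := by
    funext t
    have e10 : e1 0 = 0 := by simp [e1]
    have e11 : e1 1 = 1 := by simp [e1]
    rw [fderiv_ladder, ladderD_apply, (pt_add_smul_e1 a t).1, (pt_add_smul_e1 a t).2]
    simp only [e10, e11, mul_one, mul_zero, zero_add, dY, hc, hs₀]
    ring_nf
  rw [hfun] at h1
  have hσ : HasDerivAt (fun t : ℝ => smoothSign (c * t)) (deriv smoothSign (c * 0) * (c * 1)) 0 :=
    (hasDerivAt_smoothSign (c * 0)).comp 0 ((hasDerivAt_id 0).const_mul c)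
  have hb1 : HasDerivAt (fun t : ℝ => deriv barrier (t - 2)) (deriv (deriv barrier) (0 - 2) * 1) 0 :=
    (hasDerivAt_deriv_barrier _ |>.congr_deriv (deriv_deriv_barrier _).symm).comp 0
      ((hasDerivAt_id 0).sub_const 2)
  have hb2 : HasDerivAt (fun t : ℝ => deriv barrier (-t - 2)) (deriv (deriv barrier) (-0 - 2) * -1) 0 :=
    (hasDerivAt_deriv_barrier _ |>.congr_deriv (deriv_deriv_barrier _).symm).comp 0
      ((hasDerivAt_neg 0).sub_const 2)
  have h2 := ((((hasDerivAt_id 0).const_mul 2).sub (hσ.const_mul (2 * s₀))).add hb1).sub hb2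
  have := h1.unique h2
  rw [this]
  unfold hYY
  have hT : smoothTransition (-2) = 0 := smoothTransition.zero_of_nonpos (by norm_num)
  simp only [mul_one, mul_zero, neg_zero, zero_sub, deriv_deriv_barrier, hT, hc, hs₀]
  field_simp
  ring

/-- **The Hessian at an axis point is diagonal**: `D²q_{(a,0)}(v, w) = hXX v₀w₀ + hYY v₁w₁`.
[folklore] -/
theorem mhessian_pt (a : ℝ) (v w : 𝔼 2) :
    mhessian (𝓡 2) P.ladder (pt a 0) v w = hXX (k := k) a * (v 0 * w 0) + P.hYY a * (v 1 * w 1) := by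
  rw [MorseBirth.mhessian_model_apply]
  conv_lhs => rw [eq_smul_add_smul v, eq_smul_add_smul w]
  simp only [map_add, map_smul, _root_.add_apply, FunLike.coe_smul, Pi.smul_apply, smul_eq_mul]
  rw [hessian_xx, hessian_xy, hessian_yx, hessian_yy]
  ring

/-- The Hessian at `(a, 0)` is the weighted sum of squares `diag(hXX a, hYY a)`. [folklore] -/
theorem equivalent_weightedSumSquares_pt (a : ℝ) :
    QuadraticMap.Equivalent (mhessian (𝓡 2) P.ladder (pt a 0)).toQuadraticMap
      (QuadraticMap.weightedSumSquares ℝ ![hXX (k := k) a, P.hYY a]) := by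
  refine ⟨{ toLinearEquiv := (WithLp.linearEquiv 2 ℝ (Fin 2 → ℝ)), map_app' := fun v => ?_ }⟩
  rw [QuadraticMap.weightedSumSquares_apply, LinearMap.BilinMap.toQuadraticMap_apply, mhessian_pt]
  simp [Fin.sum_univ_two, smul_eq_mul]

/-- The Morse index at `(a, 0)` counts the negative entries of `diag(hXX a, hYY a)`. [folklore] -/
theorem morseIndex_pt (a : ℝ) :
    morseIndex (𝓡 2) P.ladder (pt a 0) =
      {i : Fin 2 | (![hXX (k := k) a, P.hYY a] : Fin 2 → ℝ) i < 0}.ncard := by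
  unfold morseIndex
  exact QuadraticForm.sigNeg_of_equiv_weightedSumSquares (P.equivalent_weightedSumSquares_pt a)

/-- Nondegeneracy at `(a, 0)` from nonvanishing diagonal entries. [folklore] -/
theorem nondegenerate_pt {a : ℝ} (hx : hXX (k := k) a ≠ 0) (hy : P.hYY a ≠ 0) :
    (mhessian (𝓡 2) P.ladder (pt a 0)).Nondegenerate :=
  FlowerModel.nondegenerate_of_diag₂ hx hy (P.mhessian_pt a)

/-! #### The entries at the critical points -/

/-- `b'` is smooth, with derivative `deriv dbump`. [folklore] -/
theorem hasDerivAt_dbump' (ξ : ℝ) : HasDerivAt dbump (deriv dbump ξ) ξ := by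
  have h : ContDiff ℝ ∞ dbump := by
    rw [← deriv_bump]; exact (contDiff_infty_iff_deriv.1 contDiff_bump).2
  exact (h.differentiable (by simp) ξ).hasDerivAt

/-- **`(s²)''` at a cell point** `a = ctr i + ξ`, `|ξ| < 1`: equals `-2 b''(ξ)`. [folklore] -/
theorem deriv_deriv_sFun_sq_cell {i : ℕ} (hi : i < k) {ξ : ℝ} (hξ : |ξ| < 1) :
    deriv (deriv (fun x => sFun k x ^ 2)) (ctr i + ξ) = -2 * deriv dbump ξ := by
  obtain ⟨h1, -, h3⟩ := ctr_add_mem hi hξ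
  set a := ctr i + ξ with ha
  -- near `a`, `(s²)' = -2 b'(x - ctr i)`
  have hopen : {x : ℝ | 1 < x ∧ |x - ctr i| < 1} ∈ 𝓝 a :=
    (isOpen_lt continuous_const continuous_id).inter
      (isOpen_lt (continuous_id.sub continuous_const).abs continuous_const) |>.mem_nhds ⟨h1, h3⟩
  have hev : deriv (fun x => sFun k x ^ 2) =ᶠ[𝓝 a] fun x => -2 * dbump (x - ctr i) := by
    refine eventuallyEq_of_mem hopen fun x hx => ?_
    rw [deriv_sFun_sq, two_mul_sFun_mul_sD_cell hi hx.2]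
  rw [hev.deriv_eq]
  have hd : HasDerivAt (fun x => -2 * dbump (x - ctr i)) (-2 * (deriv dbump (a - ctr i) * 1)) a :=
    ((hasDerivAt_dbump' _).comp a ((hasDerivAt_id a).sub_const _)).const_mul (-2)
  rw [hd.deriv, show a - ctr i = ξ by rw [ha]; ring]
  ring

/-- **`(s²)'' = 0` left of the origin** (there `s ≡ 0`). [folklore] -/
theorem deriv_deriv_sFun_sq_of_neg {a : ℝ} (ha : a < 0) :
    deriv (deriv (fun x => sFun k x ^ 2)) a = 0 := by
  have hev : (fun x => sFun k x ^ 2) =ᶠ[𝓝 a] fun _ => (0 : ℝ) :=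
    eventuallyEq_of_mem (Iio_mem_nhds ha) fun x hx => by
      rw [sFun_of_nonpos (le_of_lt hx)]; ring
  have h1 : deriv (fun x => sFun k x ^ 2) =ᶠ[𝓝 a] deriv (fun _ : ℝ => (0 : ℝ)) := hev.deriv
  rw [h1.deriv_eq]
  simp

/-- **`hXX` at a cell point**: `-2 b''(ξ)`. [folklore] -/
theorem hXX_cell {i : ℕ} (hi : i < k) {ξ : ℝ} (hξ : |ξ| < 1) : hXX (k := k) (ctr i + ξ) = -2 * deriv dbump ξ := by
  obtain ⟨h1, h2, -⟩ := ctr_add_mem hi hξ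
  unfold hXX
  rw [smoothTransition.zero_of_nonpos (by linarith), smoothTransition.zero_of_nonpos (by linarith),
    deriv_deriv_sFun_sq_cell hi hξ]
  ring

/-- **`hXX` at the cap point**: `6 T(t₀) > 0`. [folklore] -/
theorem hXX_cap : hXX (k := k) (-P.t₀) = 6 * smoothTransition P.t₀ := by
  have ht := P.t₀_pos
  have hk0 : (0 : ℝ) ≤ k := Nat.cast_nonneg k
  unfold hXX
  rw [neg_neg, smoothTransition.zero_of_nonpos (x := -P.t₀ - xR k) (by unfold xR; linarith),
    deriv_deriv_sFun_sq_of_neg (by linarith)]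
  ring

/-- `hXX > 0` at the cap point. [folklore] -/
theorem hXX_cap_pos : 0 < hXX (k := k) (-P.t₀) := by
  rw [hXX_cap]; exact mul_pos (by norm_num) (smoothTransition.pos_of_pos P.t₀_pos)

/-- **`hYY < 0` at the cell points** (`8 s² σ'(0)/κ > 2`). [folklore] -/
theorem hYY_cell_neg {i : ℕ} (hi : i < k) {ξ : ℝ} (hξ : |ξ| < 1) : P.hYY (ctr i + ξ) < 0 := by
  obtain ⟨h1, -, -⟩ := ctr_add_mem hi hξ
  unfold hYY
  have hκ := P.κ_pos
  have hs : 1 - 2 * bump 0 ≤ sFun k (ctr i + ξ) ^ 2 := uMin_le_sFun_sq h1.le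
  have hm := P.m₀_le
  have hm0 := P.m₀_pos
  have hu := uMin_pos
  have hκlt := P.κ_lt
  rw [sub_neg, lt_div_iff₀ hκ]
  calc 2 * P.κ < 2 * (4 * (1 - 2 * bump 0) * P.m₀) := by linarith
    _ = 8 * (1 - 2 * bump 0) * P.m₀ := by ring
    _ ≤ 8 * sFun k (ctr i + ξ) ^ 2 * deriv smoothSign 0 := by gcongr

/-- **`hYY = 2` at the cap point.** [folklore] -/
theorem hYY_cap : P.hYY (-P.t₀) = 2 := by
  unfold hYY; rw [sFun_of_nonpos (by linarith [P.t₀_pos])]; simp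

/-! #### Nondegeneracy and indices -/

/-- The hole maximum `(ctr i + x₁, 0)`: nondegenerate of index `2`. [folklore] -/
theorem nondegenerate_max {i : ℕ} (hi : i < k) :
    (mhessian (𝓡 2) P.ladder (pt (ctr i + P.x₁) 0)).Nondegenerate :=
  P.nondegenerate_pt (by rw [hXX_cell hi P.abs_x₁_lt]; linarith [P.deriv_dbump_x₁_pos])
    (P.hYY_cell_neg hi P.abs_x₁_lt).ne

/-- The hole maximum has index `2`. [folklore] -/
theorem morseIndex_max {i : ℕ} (hi : i < k) : morseIndex (𝓡 2) P.ladder (pt (ctr i + P.x₁) 0) = 2 := by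
  rw [morseIndex_pt]
  have h1 : hXX (k := k) (ctr i + P.x₁) < 0 := by
    rw [hXX_cell hi P.abs_x₁_lt]; linarith [P.deriv_dbump_x₁_pos]
  have h2 := P.hYY_cell_neg hi P.abs_x₁_lt
  have : {j : Fin 2 | (![hXX (k := k) (ctr i + P.x₁), P.hYY (ctr i + P.x₁)] : Fin 2 → ℝ) j < 0} = Set.univ := by
    ext j; fin_cases j <;> simp [h1, h2]
  rw [this, Set.ncard_univ, Nat.card_eq_fintype_card, Fintype.card_fin]

/-- The rung saddle `(ctr i + x₂, 0)`: nondegenerate of index `1`. [folklore] -/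
theorem nondegenerate_saddle {i : ℕ} (hi : i < k) :
    (mhessian (𝓡 2) P.ladder (pt (ctr i + P.x₂) 0)).Nondegenerate :=
  P.nondegenerate_pt (by rw [hXX_cell hi P.abs_x₂_lt]; linarith [P.deriv_dbump_x₂_neg])
    (P.hYY_cell_neg hi P.abs_x₂_lt).ne

/-- The rung saddle has index `1`. [folklore] -/
theorem morseIndex_saddle {i : ℕ} (hi : i < k) :
    morseIndex (𝓡 2) P.ladder (pt (ctr i + P.x₂) 0) = 1 := by
  rw [morseIndex_pt]
  have h1 : 0 < hXX (k := k) (ctr i + P.x₂) := by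
    rw [hXX_cell hi P.abs_x₂_lt]; linarith [P.deriv_dbump_x₂_neg]
  have h2 := P.hYY_cell_neg hi P.abs_x₂_lt
  have : {j : Fin 2 | (![hXX (k := k) (ctr i + P.x₂), P.hYY (ctr i + P.x₂)] : Fin 2 → ℝ) j < 0} = {1} := by
    ext j; fin_cases j
    · simp; linarith
    · simp [h2]
  rw [this, Set.ncard_singleton]

/-- The cap minimum `(-t₀, 0)`: nondegenerate of index `0`. [folklore] -/
theorem nondegenerate_min : (mhessian (𝓡 2) P.ladder (pt (-P.t₀) 0)).Nondegenerate :=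
  P.nondegenerate_pt P.hXX_cap_pos.ne' (by rw [P.hYY_cap]; norm_num)

/-- The cap minimum has index `0`. [folklore] -/
theorem morseIndex_min : morseIndex (𝓡 2) P.ladder (pt (-P.t₀) 0) = 0 := by
  rw [morseIndex_pt]
  have h1 := P.hXX_cap_pos
  have h2 : 0 < P.hYY (-P.t₀) := by rw [P.hYY_cap]; norm_num
  have : {j : Fin 2 | (![hXX (k := k) (-P.t₀), P.hYY (-P.t₀)] : Fin 2 → ℝ) j < 0} = ∅ := by
    ext j; fin_cases j
    · simp; linarith
    · simp; linarith
  rw [this, Set.ncard_empty]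

/-! ### §8 Values at the critical points and the level -/

/-- **The level** `c = 1 - (b(x₁) + b(x₂)) - κ S(0)/2` (halfway between the saddle and the
maximum values, up to the tilt). [folklore] -/
def level : ℝ := 1 - (bump P.x₁ + bump P.x₂) - P.κ / 2 * smoothAbs 0

/-- The guaranteed gap is at most the actual one: `Δ⋆ < b(x₂) - b(x₁)`. [folklore] -/
theorem gapStar_lt : gapStar < bump P.x₂ - bump P.x₁ := by
  have h1 := P.x₁_mem
  have h2 := P.x₂_mem
  unfold gapStar
  have hb2 : bump (1 / 2) < bump P.x₂ :=
    bump_lt_bump (by rw [abs_of_neg h2.2, abs_of_pos (by norm_num : (0:ℝ) < 1 / 2)]; linarith [h2.1])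
      (by rw [abs_of_neg h2.2]; linarith [h2.1])
  have hb1 : bump P.x₁ < bump xStar :=
    bump_lt_bump (by rw [abs_of_pos xStar_pos, abs_of_neg (by linarith [h1.2, xStar_pos])]; linarith [h1.2])
      (by rw [abs_of_pos xStar_pos]; exact xStar_lt_one)
  linarith

/-- `τ x_R < b(x₂) - b(x₁)`. [folklore] -/
theorem τ_mul_xR_lt : P.τ * xR k < bump P.x₂ - bump P.x₁ := by
  have h := P.τ_small
  have hg := P.gapStar_lt
  have : min gapStar (1 / 8) / 2 ≤ gapStar / 2 := by gcongr; exact min_le_left _ _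
  unfold xR
  linarith [gapStar_pos]

/-- `τ x_R ≤ 1/16`. [folklore] -/
theorem τ_mul_xR_le : P.τ * xR k ≤ 1 / 16 := by
  have h := P.τ_small
  have : min gapStar (1 / 8) / 2 ≤ (1 / 8) / 2 := by gcongr; exact min_le_right _ _
  unfold xR
  linarith

/-- **The value at a cell point** `(ctr i + ξ, 0)`: `τ (ctr i + ξ) + 1 - 2 b(ξ) - κ S(0)/2`.
[folklore] -/
theorem ladderFun_cell {i : ℕ} (hi : i < k) {ξ : ℝ} (hξ : |ξ| < 1) :
    P.ladderFun (ctr i + ξ) 0 = P.τ * (ctr i + ξ) + (1 - 2 * bump ξ) - P.κ / 2 * smoothAbs 0 := by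
  obtain ⟨h1, h2, h3⟩ := ctr_add_mem hi hξ
  rw [ladderFun_zero, barrier_of_nonpos (by linarith), barrier_of_nonpos (by linarith),
    sFun_sq h1.le, uCell_eq_cell hi h3, show ctr i + ξ - ctr i = ξ by ring]
  ring

/-- `p(t₀) ≤ τ t₀` (`p' = 6P` is increasing, so `p(t₀) = 6∫₀^{t₀} P ≤ 6 t₀ P(t₀) = t₀ p'(t₀)`).
[folklore] -/
theorem barrier_t₀_le : barrier P.t₀ ≤ P.τ * P.t₀ := by
  have ht := P.t₀_pos
  have hmono := monotone_rampPrim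
  unfold barrier
  have h : ∫ s in (0 : ℝ)..P.t₀, rampPrim s ≤ ∫ _ in (0 : ℝ)..P.t₀, rampPrim P.t₀ :=
    intervalIntegral.integral_mono_on (μ := MeasureTheory.volume) ht.le
      (continuous_rampPrim.intervalIntegrable _ _)
      ((continuous_const (y := rampPrim P.t₀)).intervalIntegrable _ _)
      fun s hs => hmono hs.2
  rw [intervalIntegral.integral_const, smul_eq_mul] at h
  have e : P.τ = 6 * rampPrim P.t₀ := by
    have := P.deriv_barrier_t₀; rw [deriv_barrier] at this; linarith
  rw [e]
  nlinarith

/-- **The value at the cap point**: `q(-t₀, 0) = -τ t₀ + p(t₀) - κ S(0)/2 ≤ -κ S(0)/2`. [folklore] -/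
theorem ladderFun_cap_le : P.ladderFun (-P.t₀) 0 ≤ -(P.κ / 2 * smoothAbs 0) := by
  have ht := P.t₀_pos
  have hk0 : (0 : ℝ) ≤ k := Nat.cast_nonneg k
  rw [ladderFun_zero, neg_neg, barrier_of_nonpos (t := -P.t₀ - xR k) (by unfold xR; linarith),
    sFun_of_nonpos (by linarith)]
  have := P.barrier_t₀_le
  nlinarith

/-- `κ S(0)/2 ∈ [0, 1/8]`. [folklore] -/
theorem κ_smoothAbs_zero_mem : P.κ / 2 * smoothAbs 0 ∈ Icc (0 : ℝ) (1 / 8) := by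
  have h := smoothAbs_zero_mem
  have hκ := P.κ_pos
  have hκ4 := P.κ_le
  constructor
  · exact mul_nonneg (by linarith) h.1
  · calc P.κ / 2 * smoothAbs 0 ≤ (1 / 4) / 2 * 1 := mul_le_mul (by linarith) h.2 h.1 (by norm_num)
      _ = 1 / 8 := by norm_num

/-- **The level is positive**, indeed `> 1/8` (`b ≤ b(0) = e⁻¹ < 3/8`). [folklore] -/
theorem level_gt : 1 / 8 < P.level := by
  unfold level
  have h1 := bump_le_bump_zero P.x₁
  have h2 := bump_le_bump_zero P.x₂
  have hb0 : bump 0 < 3 / 8 := by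
    rw [bump_zero]
    have h := Real.exp_one_gt_d9
    rw [Real.exp_neg, inv_lt_comm₀ (Real.exp_pos 1) (by norm_num)]
    linarith
  have h3 := P.κ_smoothAbs_zero_mem.2
  linarith

/-- **The level is below `1 - κ`** (needed for the bridges). [folklore] -/
theorem level_lt : P.level < 1 - P.κ := by
  unfold level
  have h2 : bump (1 / 2) < bump P.x₂ := by
    have h := P.x₂_mem
    exact bump_lt_bump (by rw [abs_of_neg h.2, abs_of_pos (by norm_num : (0:ℝ) < 1 / 2)]; linarith [h.1])
      (by rw [abs_of_neg h.2]; linarith [h.1])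
  -- `b(1/2) = e^{-4/3} > 1/4 ≥ κ`
  have hb : 1 / 4 < bump (1 / 2) := by
    have e : bump (1 / 2) = Real.exp (-(4 / 3)) := by
      simp only [bump, expNegInvGlue]; norm_num
    rw [e, Real.exp_neg, lt_inv_comm₀ (by norm_num) (Real.exp_pos _)]
    -- `exp (4/3) < 4`: `exp (4/3) = exp 1 * exp (1/3)` with `exp 1 < 2.72`, `exp (1/3) < 1.4`
    have h1 : Real.exp (4 / 3) = Real.exp 1 * Real.exp (1 / 3) := by
      rw [← Real.exp_add]; norm_num
    have h2 := Real.exp_one_lt_d9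
    have h3 : Real.exp (1 / 3) < 1.4 := by
      have h5 := Real.exp_bound' (x := 1 / 3) (by norm_num) (by norm_num) (n := 3) (by norm_num)
      norm_num [Finset.sum_range_succ, Nat.factorial] at h5
      linarith
    rw [h1]
    nlinarith [Real.exp_pos 1, Real.exp_pos (1 / 3)]
  have h1 := bump_nonneg P.x₁
  have h4 := P.κ_smoothAbs_zero_mem.1
  have hκ := P.κ_le
  linarith

/-- **The saddle values lie below the level.** [folklore] -/
theorem ladderFun_saddle_lt {i : ℕ} (hi : i < k) : P.ladderFun (ctr i + P.x₂) 0 < P.level := by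
  rw [P.ladderFun_cell hi P.abs_x₂_lt]
  unfold level
  obtain ⟨-, h2, -⟩ := ctr_add_mem hi P.abs_x₂_lt
  have hτ := P.τ_pos
  have h3 := P.τ_mul_xR_lt
  have : P.τ * (ctr i + P.x₂) < P.τ * xR k := by gcongr
  linarith

/-- **The maximum values lie above the level.** [folklore] -/
theorem level_lt_ladderFun_max {i : ℕ} (hi : i < k) : P.level < P.ladderFun (ctr i + P.x₁) 0 := by
  rw [P.ladderFun_cell hi P.abs_x₁_lt]
  unfold level
  obtain ⟨h1, -, -⟩ := ctr_add_mem hi P.abs_x₁_lt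
  have hτ := P.τ_pos
  have hg := P.gapStar_lt
  have : 0 < P.τ * (ctr i + P.x₁) := by positivity
  linarith [gapStar_pos]

/-- **The minimum value lies below the level.** [folklore] -/
theorem ladderFun_cap_lt : P.ladderFun (-P.t₀) 0 < P.level := by
  have h1 := P.ladderFun_cap_le
  have h2 := P.level_gt
  have h3 := P.κ_smoothAbs_zero_mem.1
  linarith

/-! ### §9 Coercivity -/

/-- **The `x`-part is coercive**: `τx + p(-x) + p(x - x_R) ≥ x² - (3/2 (x_R+1)² + 4)`. [folklore] -/
theorem xPart_ge (x : ℝ) :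
    x ^ 2 - (3 / 2 * (xR k + 1) ^ 2 + 4) ≤ P.τ * x + barrier (-x) + barrier (x - xR k) := by
  have hτ := P.τ_pos
  have hτ1 := P.τ_le_one
  have hk0 : (0 : ℝ) ≤ k := Nat.cast_nonneg k
  have hA : 1 ≤ xR k := by unfold xR; linarith
  have hp1 := barrier_nonneg (-x)
  have hp2 := barrier_nonneg (x - xR k)
  rcases le_or_gt x (-1) with h1 | h1
  · -- far left: `p(-x) ≥ 3(x+1)²`, `τ x ≥ x`
    have hb := barrier_ge (t := -x) (by linarith)
    have : x ≤ P.τ * x := by nlinarith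
    have hq : 0 ≤ 2 * x ^ 2 + 7 * x + 7 := by nlinarith [sq_nonneg (x + 7 / 4)]
    nlinarith [sq_nonneg (xR k + 1)]
  rcases le_or_gt x (xR k + 1) with h2 | h2
  · -- middle: `τ x ≥ -1`, `x² ≤ (x_R + 1)²`
    have : -1 ≤ P.τ * x := by nlinarith
    have hx2 : x ^ 2 ≤ (xR k + 1) ^ 2 := by nlinarith
    nlinarith
  · -- far right: `p(x - x_R) ≥ 3 (x - x_R - 1)²`, `τ x ≥ 0`
    have hb := barrier_ge (t := x - xR k) (by linarith)
    have : 0 ≤ P.τ * x := by nlinarith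
    nlinarith [sq_nonneg (x - 3 / 2 * (xR k + 1))]

/-- **The `y`-part is coercive**: `y² + s² - (κ/2) S(4sy/κ) + p(y-2) + p(-y-2) ≥ y² - 8`. [folklore] -/
theorem yPart_ge (x y : ℝ) :
    y ^ 2 - 8 ≤ y ^ 2 + sFun k x ^ 2 - P.κ / 2 * smoothAbs (4 * sFun k x * y / P.κ) +
      barrier (y - 2) + barrier (-y - 2) := by
  have hκ := P.κ_pos
  have hκ4 := P.κ_le
  have hs0 := sFun_nonneg k x
  have hs1 := sFun_le_one k x
  -- the regularised term: `(κ/2) S(t) ≤ 2 s |y| + κ/2 ≤ 2|y| + κ/2`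
  have hS : P.κ / 2 * smoothAbs (4 * sFun k x * y / P.κ) ≤ 2 * |y| + P.κ / 2 := by
    have h := smoothAbs_le_abs_add_one (4 * sFun k x * y / P.κ)
    have habs : |4 * sFun k x * y / P.κ| = 4 * sFun k x * |y| / P.κ := by
      rw [abs_div, abs_of_pos hκ, abs_mul, abs_of_nonneg (by positivity : (0:ℝ) ≤ 4 * sFun k x)]
    rw [habs] at h
    have h2 : P.κ / 2 * smoothAbs (4 * sFun k x * y / P.κ) ≤ P.κ / 2 * (4 * sFun k x * |y| / P.κ + 1) :=
      mul_le_mul_of_nonneg_left (by linarith) (by linarith)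
    have h3 : P.κ / 2 * (4 * sFun k x * |y| / P.κ + 1) = 2 * sFun k x * |y| + P.κ / 2 := by
      field_simp
      ring
    have h4 : 2 * sFun k x * |y| ≤ 2 * |y| := by nlinarith [abs_nonneg y]
    linarith
  -- the tails: `p(y-2) + p(-y-2) + 7 ≥ 2|y|`
  have hT : 2 * |y| ≤ barrier (y - 2) + barrier (-y - 2) + 7 := by
    have hp1 := barrier_nonneg (y - 2)
    have hp2 := barrier_nonneg (-y - 2)
    rcases le_or_gt |y| 3 with h | h
    · linarith
    · rcases le_or_gt 0 y with hy | hy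
      · rw [abs_of_nonneg hy] at h ⊢
        have hb := barrier_ge (t := y - 2) (by linarith)
        nlinarith
      · rw [abs_of_neg hy] at h ⊢
        have hb := barrier_ge (t := -y - 2) (by linarith)
        nlinarith
  nlinarith [sq_nonneg (sFun k x)]

/-- **Coercivity of the ladder**: `‖u‖² ≤ q(u) + B`. [folklore] -/
theorem norm_sq_le (u : 𝔼 2) : ‖u‖ ^ 2 ≤ P.ladder u + (3 / 2 * (xR k + 1) ^ 2 + 12) := by
  have hn : ‖u‖ ^ 2 = u 0 ^ 2 + u 1 ^ 2 := by
    rw [EuclideanSpace.norm_sq_eq, Fin.sum_univ_two]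
    simp [Real.norm_eq_abs, sq_abs]
  rw [hn]
  have h1 := P.xPart_ge (u 0)
  have h2 := P.yPart_ge (u 0) (u 1)
  unfold ladder ladderFun
  linarith

/-! ### §10 The ladder is a Morse function of a `k`-holed disc -/

/-- The cell points are not the cap point, and distinct cells/roots give distinct points:
bookkeeping. [folklore] -/
theorem pt_cell_ne_cap {i : ℕ} (hi : i < k) {ξ : ℝ} (hξ : |ξ| < 1) : pt (ctr i + ξ) 0 ≠ pt (-P.t₀) 0 := by
  intro h
  have := congrArg (fun p : 𝔼 2 => p 0) h
  simp only [pt_apply_zero] at this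
  obtain ⟨h1, -, -⟩ := ctr_add_mem hi hξ
  linarith [P.t₀_pos]

/-- Distinct cells give distinct cell points. [folklore] -/
theorem ctr_add_injective (ξ : ℝ) : Function.Injective fun i : ℕ => pt (ctr i + ξ) 0 := by
  intro i j h
  have := congrArg (fun p : 𝔼 2 => p 0) h
  simp only [pt_apply_zero, ctr] at this
  exact_mod_cast (by linarith : (i : ℝ) = j)

/-- A hole maximum is never a rung saddle. [folklore] -/
theorem pt_x₁_ne_pt_x₂ (i j : ℕ) : pt (ctr i + P.x₁) 0 ≠ pt (ctr j + P.x₂) 0 := by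
  intro h
  have := congrArg (fun p : 𝔼 2 => p 0) h
  simp only [pt_apply_zero, ctr] at this
  have h1 := P.x₁_mem; have h2 := P.x₂_mem
  -- `x₁ - x₂ = 4 (j - i)` with `x₁ - x₂ ∈ (-1, -x⋆ + 1/2) ⊂ (-1, 0)`: impossible for an integer multiple of 4
  have hd : P.x₁ - P.x₂ = 4 * ((j : ℝ) - i) := by linarith
  have hlt : P.x₁ - P.x₂ < 0 := by linarith [h1.2, h2.1, half_lt_xStar]
  have hgt : -1 < P.x₁ - P.x₂ := by linarith [h1.1, h2.2]
  rcases lt_or_ge j i with hji | hji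
  · have : (j : ℝ) + 1 ≤ i := by exact_mod_cast hji
    linarith
  · have : (i : ℝ) ≤ j := by exact_mod_cast hji
    linarith

/-- **The ladder is Morse.** [folklore] -/
theorem isMorse : IsMorse (𝓡 2) P.ladder := by
  refine ⟨contMDiff_iff_contDiff.2 P.contDiff_ladder, fun u hu => ?_⟩
  rcases (P.isMCriticalPt_iff_mem u).1 hu with rfl | ⟨i, hi, rfl | rfl⟩
  · exact P.nondegenerate_min
  · exact P.nondegenerate_max hi
  · exact P.nondegenerate_saddle hi

/-- The index-`0` critical set is the cap point. [folklore] -/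
theorem criticalSetOfIndex_zero : criticalSetOfIndex (𝓡 2) P.ladder 0 = {pt (-P.t₀) 0} := by
  ext u
  rw [mem_criticalSetOfIndex, mem_singleton_iff, P.isMCriticalPt_iff_mem]
  constructor
  · rintro ⟨h | ⟨i, hi, h | h⟩, hidx⟩
    · exact h
    · rw [h, P.morseIndex_max hi] at hidx; exact absurd hidx (by norm_num)
    · rw [h, P.morseIndex_saddle hi] at hidx; exact absurd hidx (by norm_num)
  · rintro rfl
    exact ⟨Or.inl rfl, P.morseIndex_min⟩

/-- The index-`1` critical set is the set of rung saddles. [folklore] -/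
theorem criticalSetOfIndex_one :
    criticalSetOfIndex (𝓡 2) P.ladder 1 = (fun i : ℕ => pt (ctr i + P.x₂) 0) '' (Finset.range k : Set ℕ) := by
  ext u
  rw [mem_criticalSetOfIndex, P.isMCriticalPt_iff_mem, mem_image]
  constructor
  · rintro ⟨h | ⟨i, hi, h | h⟩, hidx⟩
    · rw [h, P.morseIndex_min] at hidx; exact absurd hidx (by norm_num)
    · rw [h, P.morseIndex_max hi] at hidx; exact absurd hidx (by norm_num)
    · exact ⟨i, Finset.mem_coe.2 (Finset.mem_range.2 hi), h.symm⟩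
  · rintro ⟨i, hi, rfl⟩
    have hi' := Finset.mem_range.1 (Finset.mem_coe.1 hi)
    exact ⟨Or.inr ⟨i, hi', Or.inr rfl⟩, P.morseIndex_saddle hi'⟩

/-- The index-`2` critical set is the set of hole maxima. [folklore] -/
theorem criticalSetOfIndex_two :
    criticalSetOfIndex (𝓡 2) P.ladder 2 = (fun i : ℕ => pt (ctr i + P.x₁) 0) '' (Finset.range k : Set ℕ) := by
  ext u
  rw [mem_criticalSetOfIndex, P.isMCriticalPt_iff_mem, mem_image]
  constructor
  · rintro ⟨h | ⟨i, hi, h | h⟩, hidx⟩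
    · rw [h, P.morseIndex_min] at hidx; exact absurd hidx (by norm_num)
    · exact ⟨i, Finset.mem_coe.2 (Finset.mem_range.2 hi), h.symm⟩
    · rw [h, P.morseIndex_saddle hi] at hidx; exact absurd hidx (by norm_num)
  · rintro ⟨i, hi, rfl⟩
    have hi' := Finset.mem_range.1 (Finset.mem_coe.1 hi)
    exact ⟨Or.inr ⟨i, hi', Or.inl rfl⟩, P.morseIndex_max hi'⟩

/-- **Exactly `k` saddles.** [folklore] -/
theorem ncard_criticalSetOfIndex_one : (criticalSetOfIndex (𝓡 2) P.ladder 1).ncard = k := by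
  rw [criticalSetOfIndex_one, Set.ncard_image_of_injective _ (ctr_add_injective _), Set.ncard_coe_finset,
    Finset.card_range]

/-- **Exactly `k` maxima.** [folklore] -/
theorem ncard_criticalSetOfIndex_two : (criticalSetOfIndex (𝓡 2) P.ladder 2).ncard = k := by
  rw [criticalSetOfIndex_two, Set.ncard_image_of_injective _ (ctr_add_injective _), Set.ncard_coe_finset,
    Finset.card_range]

/-- **Main theorem of the file.**  The ladder `q` with parameters `P` is a Morse function of a
`k`-holed disc at the level `c = P.level`, in the sense of `IsHoledDiscMorseFunction`:
hence (`ThickenedHandlebodyFour`) `{q + z² + w² ≤ c} ⊂ ℝ⁴` is a compact connected orientable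
`4`-manifold with boundary carrying a handle decomposition with one `0`-handle and `k`
`1`-handles. [folklore] -/
theorem isHoledDiscMorseFunction : IsHoledDiscMorseFunction k P.ladder P.level where
  isMorse := P.isMorse
  exists_bound := ⟨_, P.norm_sq_le⟩
  finite_criticalSet := P.finite_criticalSet
  exists_index_zero := ⟨pt (-P.t₀) 0, P.criticalSetOfIndex_zero, by
    change P.ladderFun _ _ < _; simpa using P.ladderFun_cap_lt⟩
  ncard_index_one := P.ncard_criticalSetOfIndex_one
  lt_of_index_one := by
    intro u hu
    rw [criticalSetOfIndex_one] at hu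
    obtain ⟨i, hi, rfl⟩ := hu
    have hi' := Finset.mem_range.1 (Finset.mem_coe.1 hi)
    change P.ladderFun _ _ < _
    simpa using P.ladderFun_saddle_lt hi'
  lt_of_index_two := by
    intro u hmem
    rw [criticalSetOfIndex_two] at hmem
    obtain ⟨i, hi, rfl⟩ := hmem
    have hi' := Finset.mem_range.1 (Finset.mem_coe.1 hi)
    change _ < P.ladderFun _ _
    simpa using P.level_lt_ladderFun_max hi'

/-- **Existence form.**  For every `k` there is a ladder: a smooth proper Morse function
`q : ℝ² → ℝ` of a `k`-holed disc at some level `c ∈ (1/8, 1 - κ)`, equal to the straight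
bridge `τx + (|y| - 1)²` on the slab ranges `|x - (4i+2)| ≤ 1/2`, `κ/4 ≤ |y| ≤ 2` (`i < k`).
[folklore] -/
theorem exists_ladder (k : ℕ) : ∃ P : Params k, IsHoledDiscMorseFunction k P.ladder P.level :=
  ⟨(exists_params k).some, (exists_params k).some.isHoledDiscMorseFunction⟩

end Params

end Ladder

end Literature.Topology.FourManifolds
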